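import Literature.Analysis.FluidPDE.StatisticalSolutionProofs
import Literature.Analysis.FunctionSpaces.TorusTrigPoly
import Literature.Analysis.FunctionSpaces.TorusVectorParseval
import Literature.Analysis.FunctionSpaces.TorusSpectralWeakDerivative
import Literature.Analysis.FunctionSpaces.TorusFourierModes
import Literature.Analysis.FunctionSpaces.TorusCalculusProofs
import Mathlib.Analysis.Calculus.BumpFunction.InnerProduct
import Mathlib.Analysis.Calculus.LocalExtr.Basic
import HarnessLib

/-!
# Stationary statistical solutions on `T²`: the energy equation (proofs)

`Literature.Analysis.FluidPDE.StatisticalSolution` vendors, as the named fact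
`Torus.IsStationaryStatisticalSolution.energy_eq`, the mean energy *equation*
`ν ∫ ‖u‖_V² dμ = ∫ (f, u) dμ` of a stationary statistical solution of the space-periodic
Navier–Stokes equations in dimension two (Foias–Manley–Rosa–Temam 2001, Ch. IV: under the
standing hypothesis `ν > 0` of (1.1), p. 190, a stationary statistical solution in dimension two
is an invariant measure of the semigroup, Thm. 2.2, p. 205, and an invariant measure satisfies
`∫_E {ν‖u‖² − (f, u)} dμ = 0` on every energy shell, App. B.1, p. 248).

This file **proves** that fact, `Torus.IsStationaryStatisticalSolution.energy_eq_holds`, by a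
direct Galerkin argument inside the vendored (cylindrical) test class which avoids the semigroup
and uses only finite mean enstrophy (1.29) and the Liouville equation (1.30). In particular
neither the energy inequality (1.31) nor the sign of `ν` is needed, so the proof covers the fact
exactly as vendored (every real `ν`; the source treats `ν > 0`):

1. *A Parseval frame of `P_m H`.* The fields `cos(2πk·x) P_{k⊥}eⱼ`, `sin(2πk·x) P_{k⊥}eⱼ`,
   `0 < |k| ≤ m`, reproduce the Fourier truncation, `∑ (u, g) g = P_m u` and `∑ (u, g)² = |P_m u|²`
   (`sum_integral_inner_frameField_smul`, `sum_integral_inner_frameField_sq`), using the easy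
   inclusion `H ⊆ {div = 0 weakly, mean 0}` (`isWeaklyDivFree_of_mem_energySpace`).
2. *The Galerkin test functional* `galerkinTest m ha` has the radial profile
   `φ(ξ) = |ξ|² χ(|ξ|²/a)` (`χ` a fixed bump, `a > 0`), so that for **every** `u ∈ H`
   `Φ'(u) = 2 w(|P_m u|²/a) P_m u` with the bounded continuous weight `w = (tχ(t))'`, `w = 1`
   near `0` (`grad_galerkinTest`; FMRT p. 197, `Φ(u) = ρ(|P_m u|²)`, `Φ' = 2ρ'(|P_m u|²)P_m u`).
3. *The tested generator* is `2 w(|P_m u|²/a) [(f, P_m u) − ν‖∇P_m u‖² + ∫ (u⊗u):∇P_m u]`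
   (`nsGeneratorPairing_smul_fourierTruncate`), so the Liouville equation makes the weighted
   Galerkin energy balances vanish in the mean (`integral_galerkinBalance_eq_zero`).
4. *The inertial term in dimension two* (`sq_inertialPairing_fourierTruncate_le_truncNorm`):
   writing `u = P_m u + r`, the part against `P_m u` is `½ ∫ ⟪u, ∇|P_m u|²⟫ = 0` (weak
   incompressibility) and the rest is `∫ ⟪D(P_m u) u, r⟫`, bounded by
   `‖∇P_m u‖_∞ (|P_m u| |r| + |r|²)` with the two Bernstein bounds
   `‖∇P_m u‖_∞ ≤ 2√N_m ‖∇u‖`, `‖∇P_m u‖_∞ ≤ 4πm√N_m |P_m u|`, the spectral gap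
   `|r| ≤ ‖∇r‖/(2π√(m²+1))` and the lattice count `N_m = #{|k| ≤ m} ≤ (2m+1)²` in `ℤ²`, whence
   `|∫ (u⊗u):∇P_m u| ≤ (6/π) |P_m u| ‖∇u‖ ‖∇Q_m u‖ → 0`: only the `L²` norm of the *truncation*
   enters, which the weight localises (`|P_m u|² ≤ 2a` on its support), giving the dominating
   function `(6/π)√(2a) ‖∇u‖²`. (This replaces the Ladyzhenskaya inequality of FMRT
   (B.10)–(B.11) and the support bound (1.34).)
5. *Limits* by dominated convergence: `m → ∞` (`(f, P_m u) → (f, u)`, `‖∇P_m u‖² → ‖∇u‖²`,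
   `|P_m u|² → |u|²`, finite mean enstrophy (1.29)) gives `∫ w(|u|²/a)[(f, u) − ν‖∇u‖²] dμ = 0`
   for every `a > 0`, and `a → ∞` (`w(|u|²/a) → w(0) = 1`, `|w| ≤ C_w`) the energy equation.

The companion file `Literature.Analysis.FluidPDE.StatisticalSolutionProofs` (discharge of the
mean energy *inequality* `energy_le`) is imported for its basic facts on `H`: measurability of
the spectral enstrophy (`measurable_eGradNormSq_coe`), continuity of the Fourier coefficients
on `L²`, the vanishing zero mode (`mFourierCoeff_complexify_coe_zero_of_mem`),
`integral_norm_sq_coe_eq` and `pairing_eq_inner`.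

Also proved, although not needed for the above: the support bound FMRT (1.34),
`IsStationaryStatisticalSolution.ae_norm_le` (`μ`-a.e. `|u| ≤ ‖f‖_{L²}/(4π²ν)` when `ν > 0`;
the printed derivation, p. 198, has a gap, repaired by bounding the integrand of (1.31) below on
the shells `{a ≤ |u|}`), from the spectral Poincaré inequality on `H`
(`ofReal_integral_norm_sq_le_eGradNormSq`).

Remark on the vendored docstring of `energy_eq`: its locator "Ch. IV (1.14)" is not the printed
numbering (the conditions are Def. 1.3, (1.29)–(1.31), pp. 197–198, the equation is Thm. 2.2 with
App. B.1; the printed (1.14), p. 193, is the Galerkin tail inequality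
`|u − P_m u|² ≤ λ_{m+1}^{-1} ‖u − P_m u‖²`); the statement itself is proved here as vendored.

## References

* C. Foias, O. Manley, R. Rosa, R. Temam, *Navier–Stokes Equations and Turbulence*, Cambridge
  Univ. Press (2001), Ch. IV: §1.1 (1.1) p. 190, (1.8)–(1.15) pp. 192–194; §1.2 Def. 1.2–1.3,
  (1.28)–(1.34), pp. 196–198; §2 Thm. 2.2, p. 205; App. B.1, pp. 247–252. [FMRT2001]
* P. Constantin, C. Foias, *Navier–Stokes Equations*, Univ. Chicago Press (1988), Ch. 4, (4.13)
  (Stokes eigenfields on the torus). [ConstantinFoias1988]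
* L. Grafakos, *Classical Fourier Analysis*, 3rd ed. (2014), Prop. 3.2.7 (Parseval on `Tⁿ`).
-/

noncomputable section

open MeasureTheory Filter Topology UnitAddTorus
open scoped InnerProductSpace RealInnerProductSpace ENNReal NNReal

namespace Literature.Analysis.FluidPDE

namespace Torus

variable {d : Type*} [Fintype d] [DecidableEq d]

local notation "L2T " d':max => Lp (EuclideanSpace ℝ d') 2 (volume : Measure (UnitAddTorus d'))

/-! ### Consequences of membership in `H` -/

/-- The test classes: gradients of smooth scalars and constant fields, as `L²` classes.
[folklore] -/
def energyTestSet (d : Type*) [Fintype d] [DecidableEq d] : Set (L2T d) :=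
  {w | ∃ θ : UnitAddTorus d → ℝ, ∃ hθ : FunctionSpaces.Torus.IsSmooth θ,
      w = ((hθ.gradient).memLp 2).toLp (FunctionSpaces.Torus.gradient θ)} ∪
    {w | ∃ c : EuclideanSpace ℝ d, w = (memLp_const c).toLp (fun _ : UnitAddTorus d => c)}

/-- The annihilator of the test classes: a closed submodule of `L²` containing `H`. [folklore] -/
def energyAnnihilator (d : Type*) [Fintype d] [DecidableEq d] : Submodule ℝ (L2T d) :=
  ⨅ w : energyTestSet d, LinearMap.ker ((innerSL ℝ (w : L2T d)) : L2T d →ₗ[ℝ] ℝ)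

/-- Membership in the annihilator: orthogonality to every test class. [folklore] -/
theorem mem_energyAnnihilator_iff {v : L2T d} :
    v ∈ energyAnnihilator d ↔ ∀ w ∈ energyTestSet d, ⟪w, v⟫_ℝ = 0 := by
  simp only [energyAnnihilator, Submodule.mem_iInf, LinearMap.mem_ker, ContinuousLinearMap.coe_coe,
    Subtype.forall]
  rfl

/-- The annihilator is closed (an intersection of kernels of continuous functionals). [folklore] -/
theorem isClosed_energyAnnihilator : IsClosed (energyAnnihilator d : Set (L2T d)) := by
  rw [energyAnnihilator, Submodule.coe_iInf]
  exact isClosed_iInter fun w => ContinuousLinearMap.isClosed_ker _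

/-- Smooth solenoidal mean-zero fields are annihilated by the test classes (integration by parts
against gradients, `integral_inner_gradient_eq_zero_of_isDivFree`; zero mean against constants).
[folklore] -/
theorem smoothSolenoidal_subset_energyAnnihilator :
    FunctionSpaces.Torus.smoothSolenoidal d ⊆ (energyAnnihilator d : Set (L2T d)) := by
  rintro v ⟨g, hg, hdiv, hmean, hae⟩
  rw [SetLike.mem_coe, mem_energyAnnihilator_iff]
  rintro w (⟨θ, hθ, rfl⟩ | ⟨c, rfl⟩)
  · rw [real_inner_comm, ← pairing_eq_inner, pairing]
    have h1 : ∫ x, ⟪(v : UnitAddTorus d → EuclideanSpace ℝ d) x, FunctionSpaces.Torus.gradient θ x⟫_ℝ =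
        ∫ x, ⟪g x, FunctionSpaces.Torus.gradient θ x⟫_ℝ := by
      refine integral_congr_ae ?_
      filter_upwards [hae] with x hx
      rw [hx]
    rw [h1, show (fun x => ⟪g x, FunctionSpaces.Torus.gradient θ x⟫_ℝ) = fun x => ⟪FunctionSpaces.Torus.gradient θ x, g x⟫_ℝ from
      funext fun x => real_inner_comm _ _]
    exact FunctionSpaces.Torus.integral_inner_gradient_eq_zero_of_isDivFree hg hθ hdiv
  · rw [real_inner_comm, ← pairing_eq_inner, pairing]
    have h1 : ∫ x, ⟪(v : UnitAddTorus d → EuclideanSpace ℝ d) x, c⟫_ℝ = ∫ x, ⟪c, g x⟫_ℝ := by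
      refine integral_congr_ae ?_
      filter_upwards [hae] with x hx
      rw [hx, real_inner_comm]
    rw [h1, integral_inner hg.integrable, hmean, inner_zero_right]

/-- `H` is contained in the annihilator of the test classes. [folklore] -/
theorem energySpace_le_energyAnnihilator : FunctionSpaces.Torus.energySpace d ≤ energyAnnihilator d :=
  Submodule.topologicalClosure_minimal _
    (Submodule.span_le.2 smoothSolenoidal_subset_energyAnnihilator)
    isClosed_energyAnnihilator

/-- Elements of `H` are weakly divergence free. [folklore] -/
theorem isWeaklyDivFree_of_mem_energySpace {v : L2T d} (hv : v ∈ FunctionSpaces.Torus.energySpace d) :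
    FunctionSpaces.Torus.IsWeaklyDivFree (v : UnitAddTorus d → EuclideanSpace ℝ d) := by
  intro θ hθ
  have h := (mem_energyAnnihilator_iff.1 (energySpace_le_energyAnnihilator hv)) _
    (Or.inl ⟨θ, hθ, rfl⟩)
  rwa [real_inner_comm, ← pairing_eq_inner, pairing] at h

/-- Elements of `H` have zero mean. [folklore] -/
theorem integral_eq_zero_of_mem_energySpace {v : L2T d} (hv : v ∈ FunctionSpaces.Torus.energySpace d) :
    ∫ x, (v : UnitAddTorus d → EuclideanSpace ℝ d) x = 0 := by
  have hint : Integrable (v : UnitAddTorus d → EuclideanSpace ℝ d) volume :=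
    (Lp.memLp v).integrable one_le_two
  refine integral_eq_zero_of_forall_integral_inner_eq_zero ℝ _ hint fun c => ?_
  have h := (mem_energyAnnihilator_iff.1 (energySpace_le_energyAnnihilator hv)) _
    (Or.inr ⟨c, rfl⟩)
  rw [real_inner_comm, ← pairing_eq_inner, pairing] at h
  rw [show (fun x => ⟪c, (v : UnitAddTorus d → EuclideanSpace ℝ d) x⟫_ℝ) =
      fun x => ⟪(v : UnitAddTorus d → EuclideanSpace ℝ d) x, c⟫_ℝ from
    funext fun x => real_inner_comm _ _]
  exact h

/-! ### Poincaré on `H` and integrability under a finite-enstrophy measure -/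

/-- **Poincaré inequality on `H`, spectral form**: `4π² ∫ ‖v‖² ≤ ‖∇v‖₂²` in `ℝ≥0∞` for `v ∈ H`
(the mean mode vanishes and `|k|² ≥ 1` otherwise; FMRT 2001, Ch. IV (1.13) with
`λ₁ = 4π²` on the unit torus). [cite: FMRT2001, Ch. IV (1.13), p. 193] -/
theorem ofReal_integral_norm_sq_le_eGradNormSq {v : L2T d} (hv : v ∈ FunctionSpaces.Torus.energySpace d) :
    ENNReal.ofReal (4 * Real.pi ^ 2) *
        ENNReal.ofReal (∫ x, ‖(v : UnitAddTorus d → EuclideanSpace ℝ d) x‖ ^ 2) ≤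
      FunctionSpaces.Torus.eGradNormSq (v : UnitAddTorus d → EuclideanSpace ℝ d) := by
  have hmem : MemLp (v : UnitAddTorus d → EuclideanSpace ℝ d) 2 volume := Lp.memLp v
  have hpar := FunctionSpaces.Torus.hasSum_sq_norm_mFourierCoeff_complexify hmem
  rw [FunctionSpaces.Torus.eGradNormSq_eq_tsum, ← hpar.tsum_eq,
    ENNReal.ofReal_tsum_of_nonneg (fun k => sq_nonneg _) hpar.summable]
  refine mul_le_mul_right (ENNReal.tsum_le_tsum fun k => ?_) _
  rw [← ofReal_norm, ← ENNReal.ofReal_pow (norm_nonneg _)]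
  by_cases hk : k = 0
  · subst hk
    rw [mFourierCoeff_complexify_coe_zero_of_mem hv]
    simp
  · calc ENNReal.ofReal (‖mFourierCoeff (FunctionSpaces.EuclideanSpace.complexify ∘
          (v : UnitAddTorus d → EuclideanSpace ℝ d)) k‖ ^ 2)
        = 1 * ENNReal.ofReal (‖mFourierCoeff (FunctionSpaces.EuclideanSpace.complexify ∘
          (v : UnitAddTorus d → EuclideanSpace ℝ d)) k‖ ^ 2) := (one_mul _).symm
      _ ≤ _ := by
        gcongr
        rw [← ENNReal.ofReal_one]
        exact ENNReal.ofReal_le_ofReal (one_le_freqNormSq hk)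

/-- **Poincaré inequality on `H`, real form**: `4π² ‖u‖² ≤ ‖∇u‖₂²` whenever the right-hand side
is finite (FMRT 2001, Ch. IV (1.13), `λ₁ = 4π²`). [cite: FMRT2001, Ch. IV (1.13), p. 193] -/
theorem norm_sq_le_toReal_eGradNormSq (u : FunctionSpaces.Torus.energySpace d)
    (hfin : FunctionSpaces.Torus.eGradNormSq (((u : L2T d)) : UnitAddTorus d → EuclideanSpace ℝ d) ≠ ⊤) :
    4 * Real.pi ^ 2 * ‖u‖ ^ 2 ≤
      (FunctionSpaces.Torus.eGradNormSq (((u : L2T d)) : UnitAddTorus d → EuclideanSpace ℝ d)).toReal := by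
  have h := ofReal_integral_norm_sq_le_eGradNormSq u.2
  rw [integral_norm_sq_coe_eq, ← ENNReal.ofReal_mul (by positivity)] at h
  exact (ENNReal.ofReal_le_iff_le_toReal hfin).1 h

/-- The `L²` pairing with a fixed `L²` field is continuous on `H`. [folklore] -/
theorem continuous_pairing_coe {f : UnitAddTorus d → EuclideanSpace ℝ d} (hf : MemLp f 2 volume) :
    Continuous fun u : FunctionSpaces.Torus.energySpace d => pairing (u : L2T d) f := by
  have h : (fun u : FunctionSpaces.Torus.energySpace d => pairing (u : L2T d) f) =
      fun u : FunctionSpaces.Torus.energySpace d => ⟪(u : L2T d), hf.toLp f⟫_ℝ :=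
    funext fun u => pairing_eq_inner hf _
  rw [h]
  exact continuous_subtype_val.inner continuous_const

/-- Cauchy–Schwarz for the pairing: `|(u, f)| ≤ ‖u‖ ‖f‖_{L²}`. [folklore] -/
theorem abs_pairing_coe_le {f : UnitAddTorus d → EuclideanSpace ℝ d} (hf : MemLp f 2 volume)
    (u : FunctionSpaces.Torus.energySpace d) : |pairing (u : L2T d) f| ≤ ‖u‖ * ‖hf.toLp f‖ := by
  rw [pairing_eq_inner hf, Submodule.coe_norm]
  exact abs_real_inner_le_norm _ _

section Measure

variable {ν : ℝ} {f : UnitAddTorus d → EuclideanSpace ℝ d} {μ : Measure (FunctionSpaces.Torus.energySpace d)}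

/-- Under a stationary statistical solution, `μ`-a.e. `u` has finite enstrophy
(FMRT 2001, Ch. IV, remark after (1.28): `μ(H \\ V) = 0`).
[cite: FMRT2001, Ch. IV (1.28)–(1.29), p. 197] -/
theorem IsStationaryStatisticalSolution.ae_eGradNormSq_lt_top
    (hμ : IsStationaryStatisticalSolution ν f μ) :
    ∀ᵐ u : FunctionSpaces.Torus.energySpace d ∂μ,
      FunctionSpaces.Torus.eGradNormSq (((u : L2T d)) : UnitAddTorus d → EuclideanSpace ℝ d) < ⊤ :=
  ae_lt_top measurable_eGradNormSq_coe hμ.enstrophy_finite.ne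

/-- The enstrophy `u ↦ ‖∇u‖₂²` is `μ`-integrable (FMRT 2001, Ch. IV (1.29)).
[cite: FMRT2001, Ch. IV (1.29), p. 197] -/
theorem IsStationaryStatisticalSolution.integrable_toReal_eGradNormSq
    (hμ : IsStationaryStatisticalSolution ν f μ) :
    Integrable (fun u : FunctionSpaces.Torus.energySpace d =>
      (FunctionSpaces.Torus.eGradNormSq (((u : L2T d)) : UnitAddTorus d → EuclideanSpace ℝ d)).toReal) μ :=
  integrable_toReal_of_lintegral_ne_top measurable_eGradNormSq_coe.aemeasurable
    hμ.enstrophy_finite.ne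

/-- The energy `u ↦ ‖u‖²` is `μ`-integrable (Poincaré and (1.29)). [folklore] -/
theorem IsStationaryStatisticalSolution.integrable_norm_sq
    (hμ : IsStationaryStatisticalSolution ν f μ) :
    Integrable (fun u : FunctionSpaces.Torus.energySpace d => ‖u‖ ^ 2) μ := by
  refine Integrable.mono' (hμ.integrable_toReal_eGradNormSq.div_const (4 * Real.pi ^ 2))
    (continuous_norm.pow 2).aestronglyMeasurable ?_
  filter_upwards [hμ.ae_eGradNormSq_lt_top] with u hu
  rw [Real.norm_of_nonneg (sq_nonneg _), le_div_iff₀ (by positivity), mul_comm]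
  exact norm_sq_le_toReal_eGradNormSq u hu.ne

/-- The norm `u ↦ ‖u‖` is `μ`-integrable. [folklore] -/
theorem IsStationaryStatisticalSolution.integrable_norm
    (hμ : IsStationaryStatisticalSolution ν f μ) :
    Integrable (fun u : FunctionSpaces.Torus.energySpace d => ‖u‖) μ := by
  haveI := hμ.prob
  refine Integrable.mono' ((integrable_const (1 : ℝ)).add hμ.integrable_norm_sq)
    continuous_norm.aestronglyMeasurable (ae_of_all _ fun u => ?_)
  rw [Real.norm_of_nonneg (norm_nonneg _), Pi.add_apply]
  nlinarith [norm_nonneg u, sq_nonneg (‖u‖ - 1)]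

/-- The pairing `u ↦ (u, f)` is `μ`-integrable for `f ∈ L²`. [folklore] -/
theorem IsStationaryStatisticalSolution.integrable_pairing
    (hμ : IsStationaryStatisticalSolution ν f μ) (hf : MemLp f 2 volume) :
    Integrable (fun u : FunctionSpaces.Torus.energySpace d => pairing (u : L2T d) f) μ := by
  refine Integrable.mono' (hμ.integrable_norm.mul_const ‖hf.toLp f‖)
    (continuous_pairing_coe hf).aestronglyMeasurable (ae_of_all _ fun u => ?_)
  rw [Real.norm_eq_abs]
  exact abs_pairing_coe_le hf u

/-- **Support bound** (FMRT 2001, Ch. IV (1.34), p. 198): for `0 < ν` a stationary statistical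
solution is carried by the ball `{|u| ≤ ‖f‖_{L²} / (ν λ₁)}`, `λ₁ = 4π²`. (The printed derivation
concludes from `∫_E (|u|² − c) dμ ≤ 0`; here one uses instead that on the shell
`E = {a ≤ |u|}`, `a > ‖f‖/(νλ₁)`, the integrand of (1.31) is bounded below by the positive
constant `a (νλ₁ a − ‖f‖)`, whence `μ(E) = 0`.) [cite: FMRT2001, Ch. IV (1.34), p. 198] -/
theorem IsStationaryStatisticalSolution.ae_norm_le (hν : 0 < ν)
    (hμ : IsStationaryStatisticalSolution ν f μ) (hf : MemLp f 2 volume) :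
    ∀ᵐ u : FunctionSpaces.Torus.energySpace d ∂μ, ‖u‖ ≤ ‖hf.toLp f‖ / (4 * Real.pi ^ 2 * ν) := by
  haveI := hμ.prob
  set F : ℝ := ‖hf.toLp f‖ with hF
  set R₀ : ℝ := F / (4 * Real.pi ^ 2 * ν) with hR₀
  have hF0 : 0 ≤ F := norm_nonneg _
  have hlam : 0 < 4 * Real.pi ^ 2 * ν := by positivity
  have hR₀0 : 0 ≤ R₀ := div_nonneg hF0 hlam.le
  -- the integrand of the energy inequality and its integrability
  set I : FunctionSpaces.Torus.energySpace d → ℝ := fun u =>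
    ν * (FunctionSpaces.Torus.eGradNormSq (((u : L2T d)) : UnitAddTorus d → EuclideanSpace ℝ d)).toReal -
      pairing (u : L2T d) f with hI
  have hIint : Integrable I μ :=
    (hμ.integrable_toReal_eGradNormSq.const_mul ν).sub (hμ.integrable_pairing hf)
  -- Step 1: every shell `{a ≤ ‖u‖}` with `a > R₀` is `μ`-null
  have hnull : ∀ a : ℝ, R₀ < a → μ {u : FunctionSpaces.Torus.energySpace d | a ≤ ‖u‖} = 0 := by
    intro a ha
    have ha0 : 0 < a := lt_of_le_of_lt hR₀0 ha
    have hgap : 0 < 4 * Real.pi ^ 2 * ν * a - F := by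
      rw [hR₀, div_lt_iff₀ hlam] at ha
      linarith
    set c : ℝ := a * (4 * Real.pi ^ 2 * ν * a - F) with hc
    have hc0 : 0 < c := mul_pos ha0 hgap
    set S : Set (FunctionSpaces.Torus.energySpace d) := {u | a ≤ ‖u‖} with hS
    have hSm : MeasurableSet S := measurableSet_le measurable_const continuous_norm.measurable
    -- the energy inequality on the shell `[a², ∞)`
    have hineq := hμ.energy_ineq ((ENNReal.ofReal a) ^ 2) ⊤ (by simp)
    have hset : {u : FunctionSpaces.Torus.energySpace d | ENNReal.ofReal a ^ 2 ≤ ‖u‖ₑ ^ 2 ∧ ‖u‖ₑ ^ 2 < ⊤} = S := by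
      ext u
      simp only [Set.mem_setOf_eq, hS]
      constructor
      · rintro ⟨h1, -⟩
        by_contra hlt
        rw [not_le] at hlt
        have : ‖u‖ₑ ^ 2 < ENNReal.ofReal a ^ 2 := by
          rw [← ofReal_norm]
          exact (ENNReal.pow_lt_pow_left_iff two_ne_zero).2
            ((ENNReal.ofReal_lt_ofReal_iff ha0).2 hlt)
        exact absurd h1 (not_le.2 this)
      · intro h
        refine ⟨?_, ENNReal.pow_lt_top enorm_lt_top⟩
        rw [← ofReal_norm]
        exact pow_le_pow_left' (ENNReal.ofReal_le_ofReal h) 2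
    rw [hset] at hineq
    change ∫ u in S, I u ∂μ ≤ 0 at hineq
    -- lower bound of the integrand on the shell
    have hlow : ∀ᵐ u ∂μ, u ∈ S → c ≤ I u := by
      filter_upwards [hμ.ae_eGradNormSq_lt_top] with u hu huS
      have hP := norm_sq_le_toReal_eGradNormSq u hu.ne
      have hp : pairing (u : L2T d) f ≤ ‖u‖ * F := (le_abs_self _).trans (abs_pairing_coe_le hf u)
      have hua : a ≤ ‖u‖ := huS
      have h1 : c ≤ ‖u‖ * (4 * Real.pi ^ 2 * ν * ‖u‖ - F) := by
        rw [hc]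
        apply mul_le_mul hua _ hgap.le (norm_nonneg _)
        nlinarith
      calc c ≤ ‖u‖ * (4 * Real.pi ^ 2 * ν * ‖u‖ - F) := h1
        _ = ν * (4 * Real.pi ^ 2 * ‖u‖ ^ 2) - ‖u‖ * F := by ring
        _ ≤ I u := by
          rw [hI]
          dsimp only
          nlinarith
    have hmono : ∫ u in S, c ∂μ ≤ ∫ u in S, I u ∂μ := by
      refine setIntegral_mono_on_ae (integrableOn_const) hIint.integrableOn hSm ?_
      exact hlow
    have hcS : ∫ u in S, c ∂μ = c * μ.real S := by
      rw [setIntegral_const, smul_eq_mul, mul_comm]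
    rw [hcS] at hmono
    have hreal : μ.real S ≤ 0 := by
      by_contra hpos
      rw [not_le] at hpos
      have := mul_pos hc0 hpos
      linarith
    have hreal0 : μ.real S = 0 := le_antisymm hreal measureReal_nonneg
    exact (measureReal_eq_zero_iff (measure_ne_top μ S)).1 hreal0
  -- Step 2: exhaust `{R₀ < ‖u‖}` by the shells `{R₀ + 1/(n+1) ≤ ‖u‖}`
  have hsub : {u : FunctionSpaces.Torus.energySpace d | R₀ < ‖u‖} ⊆ ⋃ n : ℕ, {u | R₀ + 1 / ((n : ℝ) + 1) ≤ ‖u‖} := by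
    intro u hu
    simp only [Set.mem_setOf_eq] at hu
    obtain ⟨n, hn⟩ := exists_nat_one_div_lt (sub_pos.2 hu)
    exact Set.mem_iUnion.2 ⟨n, by simp only [Set.mem_setOf_eq]; linarith⟩
  have hU : μ (⋃ n : ℕ, {u : FunctionSpaces.Torus.energySpace d | R₀ + 1 / ((n : ℝ) + 1) ≤ ‖u‖}) = 0 :=
    measure_iUnion_null fun n => hnull _ (by
      have : (0 : ℝ) < 1 / ((n : ℝ) + 1) := by positivity
      linarith)
  rw [ae_iff]
  refine measure_mono_null (fun u hu => hsub ?_) hU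
  simpa only [Set.mem_setOf_eq, not_le] using hu

end Measure


/-! ### The Galerkin frame: amplitudes -/

section Frame

omit [DecidableEq d] in
/-- `|k|² ≠ 0` for `k ≠ 0`. [folklore] -/
theorem freqNormSq_ne_zero {k : d → ℤ} (hk : k ≠ 0) : FunctionSpaces.Torus.freqNormSq k ≠ 0 :=
  (lt_of_lt_of_le one_pos (one_le_freqNormSq hk)).ne'

/-- The `j`-th standard basis vector projected onto `k^⊥`: `eⱼ − (kⱼ/|k|²) k`. [folklore] -/
def perpVec (k : d → ℤ) (j : d) : EuclideanSpace ℝ d :=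
  EuclideanSpace.single j 1 - ((k j : ℝ) / FunctionSpaces.Torus.freqNormSq k) • FunctionSpaces.Torus.latticeVec k

/-- Coordinates of `perpVec`. [folklore] -/
theorem perpVec_apply (k : d → ℤ) (j i : d) :
    perpVec k j i = (if i = j then 1 else 0) - (k j : ℝ) / FunctionSpaces.Torus.freqNormSq k * k i := by
  simp [perpVec]

/-- Coordinates of `perpVec`, cast to `ℂ`. [folklore] -/
theorem perpVec_apply_complex (k : d → ℤ) (j i : d) :
    ((perpVec k j i : ℝ) : ℂ) =
      (if i = j then 1 else 0) - (k j : ℂ) / (FunctionSpaces.Torus.freqNormSq k : ℂ) * (k i : ℂ) := by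
  rw [perpVec_apply]
  split_ifs <;> push_cast <;> ring

/-- `perpVec k j ⊥ k`. [folklore] -/
theorem sum_mul_perpVec {k : d → ℤ} (hk : k ≠ 0) (j : d) :
    ∑ i, (k i : ℂ) * (perpVec k j i : ℂ) = 0 := by
  have hR : ∑ i, (k i : ℝ) * perpVec k j i = 0 := by
    simp_rw [perpVec_apply, mul_sub, Finset.sum_sub_distrib, mul_ite, mul_one, mul_zero,
      Finset.sum_ite_eq' Finset.univ j, Finset.mem_univ, if_true]
    have : ∑ i, (k i : ℝ) * ((k j : ℝ) / FunctionSpaces.Torus.freqNormSq k * k i) =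
        (k j : ℝ) / FunctionSpaces.Torus.freqNormSq k * ∑ i, ((k i : ℝ)) ^ 2 := by
      rw [Finset.mul_sum]
      exact Finset.sum_congr rfl fun i _ => by ring
    rw [this, show ∑ i, ((k i : ℝ)) ^ 2 = FunctionSpaces.Torus.freqNormSq k from rfl,
      div_mul_cancel₀ _ (freqNormSq_ne_zero hk), sub_self]
  have := congrArg (fun r : ℝ => (r : ℂ)) hR
  simpa using this

/-- For transversal `z ∈ ℂ^d` (`k · z = 0`), the bilinear pairing with `perpVec k j` returns the
coordinate `z j`. [folklore] -/
theorem sum_mul_perpVec_of_transversal {k : d → ℤ} {z : EuclideanSpace ℂ d}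
    (hz : ∑ i, (k i : ℂ) * z i = 0) (j : d) : ∑ l, z l * (perpVec k j l : ℂ) = z j := by
  simp_rw [perpVec_apply_complex, mul_sub, Finset.sum_sub_distrib, mul_ite, mul_one, mul_zero,
    Finset.sum_ite_eq' Finset.univ j, Finset.mem_univ, if_true]
  have : ∑ l, z l * ((k j : ℂ) / (FunctionSpaces.Torus.freqNormSq k : ℂ) * (k l : ℂ)) =
      (k j : ℂ) / (FunctionSpaces.Torus.freqNormSq k : ℂ) * ∑ l, (k l : ℂ) * z l := by
    rw [Finset.mul_sum]
    exact Finset.sum_congr rfl fun l _ => by ring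
  rw [this, hz, mul_zero, sub_zero]

/-- For transversal `z`, `∑ⱼ zⱼ • perpVec k j = z` (a Parseval frame of `k^⊥`). [folklore] -/
theorem sum_smul_complexify_perpVec {k : d → ℤ} {z : EuclideanSpace ℂ d}
    (hz : ∑ i, (k i : ℂ) * z i = 0) :
    ∑ j, z j • FunctionSpaces.EuclideanSpace.complexify (perpVec k j) = z := by
  ext i
  simp only [WithLp.ofLp_sum, Finset.sum_apply, PiLp.smul_apply, FunctionSpaces.EuclideanSpace.complexify_apply,
    smul_eq_mul]
  simp_rw [perpVec_apply_complex, mul_sub, Finset.sum_sub_distrib, mul_ite, mul_one, mul_zero,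
    Finset.sum_ite_eq Finset.univ i, Finset.mem_univ, if_true]
  have : ∑ j, z j * ((k j : ℂ) / (FunctionSpaces.Torus.freqNormSq k : ℂ) * (k i : ℂ)) =
      (k i : ℂ) / (FunctionSpaces.Torus.freqNormSq k : ℂ) * ∑ j, (k j : ℂ) * z j := by
    rw [Finset.mul_sum]
    exact Finset.sum_congr rfl fun j _ => by ring
  rw [this, hz, mul_zero, sub_zero]

/-- The two frame amplitudes of frequency `k` and direction `j`: `perpVec k j` (cosine phase,
`c = true`) and `-i • perpVec k j` (sine phase, `c = false`), as vectors of `ℂ^d`. [folklore] -/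
def frameVec (k : d → ℤ) (j : d) : Bool → EuclideanSpace ℂ d
  | true => FunctionSpaces.EuclideanSpace.complexify (perpVec k j)
  | false => (-Complex.I) • FunctionSpaces.EuclideanSpace.complexify (perpVec k j)

/-- The frame amplitudes are transversal. [folklore] -/
theorem sum_mul_frameVec {k : d → ℤ} (hk : k ≠ 0) (j : d) (c : Bool) :
    ∑ i, (k i : ℂ) * frameVec k j c i = 0 := by
  cases c
  · simp only [frameVec, PiLp.smul_apply, smul_eq_mul, FunctionSpaces.EuclideanSpace.complexify_apply]
    rw [show ∑ i, (k i : ℂ) * (-Complex.I * (perpVec k j i : ℂ)) =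
        -Complex.I * ∑ i, (k i : ℂ) * (perpVec k j i : ℂ) by
      rw [Finset.mul_sum]; exact Finset.sum_congr rfl fun i _ => by ring]
    rw [sum_mul_perpVec hk, mul_zero]
  · simp only [frameVec, FunctionSpaces.EuclideanSpace.complexify_apply]
    exact sum_mul_perpVec hk j

omit [DecidableEq d] in
/-- Real part of the pairing with a complexified real vector. [folklore] -/
theorem re_inner_complexify_eq_sum (z : EuclideanSpace ℂ d) (a : EuclideanSpace ℝ d) :
    (inner ℂ z (FunctionSpaces.EuclideanSpace.complexify a)).re = ∑ i, (z i).re * a i := by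
  simp only [PiLp.inner_apply, FunctionSpaces.EuclideanSpace.complexify_apply, RCLike.inner_apply, Complex.re_sum]
  refine Finset.sum_congr rfl fun i _ => ?_
  simp [Complex.mul_re, mul_comm]

omit [DecidableEq d] in
/-- Real part of the pairing with `-i` times a complexified real vector. [folklore] -/
theorem re_inner_neg_I_smul_complexify_eq_sum (z : EuclideanSpace ℂ d) (a : EuclideanSpace ℝ d) :
    (inner ℂ z ((-Complex.I) • FunctionSpaces.EuclideanSpace.complexify a)).re = -∑ i, (z i).im * a i := by
  rw [inner_smul_right]
  simp only [PiLp.inner_apply, FunctionSpaces.EuclideanSpace.complexify_apply, RCLike.inner_apply, neg_mul,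
    Complex.neg_re, Complex.mul_re, Complex.I_re, zero_mul, Complex.I_im, one_mul, zero_sub,
    neg_neg, Complex.im_sum]
  rw [← Finset.sum_neg_distrib]
  refine Finset.sum_congr rfl fun i _ => ?_
  simp [Complex.mul_im, mul_comm]

/-- **The two phases recombine**: `∑_c Re⟪z, frameVec k j c⟫ • frameVec k j c = w • perpVec k j`
with `w = ∑ₗ zₗ (perpVec k j)ₗ`. [folklore] -/
theorem sum_re_inner_frameVec_smul (k : d → ℤ) (j : d) (z : EuclideanSpace ℂ d) :
    ∑ c, ((inner ℂ z (frameVec k j c)).re : ℂ) • frameVec k j c =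
      (∑ l, z l * (perpVec k j l : ℂ)) • FunctionSpaces.EuclideanSpace.complexify (perpVec k j) := by
  rw [Fintype.sum_bool]
  simp only [frameVec]
  rw [re_inner_complexify_eq_sum, re_inner_neg_I_smul_complexify_eq_sum, smul_smul, ← add_smul]
  congr 1
  push_cast
  rw [neg_mul_neg, Finset.sum_mul, ← Finset.sum_add_distrib]
  refine Finset.sum_congr rfl fun l _ => ?_
  conv_rhs => rw [← Complex.re_add_im (z l)]
  ring

/-- Sum of squares of the two phase pairings:
`∑_c (Re⟪z, frameVec k j c⟫)² = |∑ₗ zₗ (perpVec k j)ₗ|²`.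
[folklore] -/
theorem sum_sq_re_inner_frameVec (k : d → ℤ) (j : d) (z : EuclideanSpace ℂ d) :
    ∑ c, ((inner ℂ z (frameVec k j c)).re) ^ 2 = ‖∑ l, z l * (perpVec k j l : ℂ)‖ ^ 2 := by
  rw [Fintype.sum_bool]
  simp only [frameVec]
  rw [re_inner_complexify_eq_sum, re_inner_neg_I_smul_complexify_eq_sum, neg_sq,
    Complex.sq_norm, Complex.normSq_apply, Complex.re_sum, Complex.im_sum]
  have h1 : ∑ i, (z i * (perpVec k j i : ℂ)).re = ∑ i, (z i).re * perpVec k j i :=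
    Finset.sum_congr rfl fun i _ => by simp [Complex.mul_re]
  have h2 : ∑ i, (z i * (perpVec k j i : ℂ)).im = ∑ i, (z i).im * perpVec k j i :=
    Finset.sum_congr rfl fun i _ => by simp [Complex.mul_im]
  rw [h1, h2]
  ring

/-- **Frame identity at one frequency**: for transversal `z`,
`∑ⱼ ∑_c Re⟪z, frameVec k j c⟫ • frameVec k j c = z`. [folklore] -/
theorem sum_sum_re_inner_frameVec_smul {k : d → ℤ} {z : EuclideanSpace ℂ d}
    (hz : ∑ i, (k i : ℂ) * z i = 0) :
    ∑ j, ∑ c, ((inner ℂ z (frameVec k j c)).re : ℂ) • frameVec k j c = z := by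
  simp_rw [sum_re_inner_frameVec_smul, sum_mul_perpVec_of_transversal hz]
  exact sum_smul_complexify_perpVec hz

/-- **Parseval identity at one frequency**: for transversal `z`,
`∑ⱼ ∑_c (Re⟪z, frameVec k j c⟫)² = ‖z‖²`. [folklore] -/
theorem sum_sum_sq_re_inner_frameVec {k : d → ℤ} {z : EuclideanSpace ℂ d}
    (hz : ∑ i, (k i : ℂ) * z i = 0) :
    ∑ j, ∑ c, ((inner ℂ z (frameVec k j c)).re) ^ 2 = ‖z‖ ^ 2 := by
  simp_rw [sum_sq_re_inner_frameVec, sum_mul_perpVec_of_transversal hz]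
  rw [EuclideanSpace.norm_sq_eq]

end Frame


/-! ### The Galerkin frame: fields -/

section FrameField

/-- The non-zero frequencies of the ball: `0 < |k|² ≤ m²`. [folklore] -/
def freqBall₀ (m : ℕ) : Finset (d → ℤ) := (FunctionSpaces.Torus.freqBall m).erase 0

/-- The frame field of frequency `k`, direction `j` and phase `c`: `Re (e_k • frameVec k j c)`,
i.e. `cos(2πk·x) perpVec k j` (`c = true`) and `sin(2πk·x) perpVec k j` (`c = false`)
(the real Stokes eigenfields of the periodic case; Constantin–Foias 1988, Ch. 4, (4.13); FMRT 2001,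
Ch. IV §1.1, p. 193: the eigenfunctions `w_m` of `A`). [cite: ConstantinFoias1988, Ch. 4 (4.13)] -/
def frameField (k : d → ℤ) (j : d) (c : Bool) : UnitAddTorus d → EuclideanSpace ℝ d :=
  FunctionSpaces.Torus.realTrigPoly {k} fun _ => frameVec k j c

/-- Frame fields are divergence free (their amplitudes are transversal). [folklore] -/
theorem isDivFree_frameField {k : d → ℤ} (hk : k ≠ 0) (j : d) (c : Bool) :
    FunctionSpaces.Torus.IsDivFree (frameField k j c) :=
  FunctionSpaces.Torus.isDivFree_realTrigPoly_singleton (sum_mul_frameVec hk j c)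

/-- Frame fields have zero mean (`k ≠ 0`). [folklore] -/
theorem integral_frameField {k : d → ℤ} (hk : k ≠ 0) (j : d) (c : Bool) :
    ∫ x, frameField k j c x = 0 := by
  simp_rw [frameField, FunctionSpaces.Torus.realTrigPoly_singleton_apply]
  have hi : Integrable (fun x : UnitAddTorus d => mFourier k x • frameVec k j c) volume :=
    ((mFourier k).continuous.smul continuous_const).integrable_unitAddTorus
  rw [ContinuousLinearMap.integral_comp_comm _ hi]
  rw [integral_smul_const, FunctionSpaces.Torus.integral_mFourier, if_neg hk, zero_smul, map_zero]

omit [DecidableEq d] in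
/-- A real multiple of a real mode is the real mode of the multiplied amplitude. [folklore] -/
theorem smul_realPart_mFourier_smul (r : ℝ) (k : d → ℤ) (x : UnitAddTorus d)
    (z : EuclideanSpace ℂ d) :
    r • FunctionSpaces.EuclideanSpace.realPart (mFourier k x • z) =
      FunctionSpaces.EuclideanSpace.realPart (mFourier k x • ((r : ℂ) • z)) := by
  rw [← map_smul, smul_comm, Complex.coe_smul]

/-- **The frame reproduces the truncation** (Parseval frame of `P_m H`): for `v ∈ H`,
`∑_{0<|k|≤m} ∑ⱼ ∑_c (v, g_{kjc}) g_{kjc} = P_m v` pointwise. [folklore] -/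
theorem sum_integral_inner_frameField_smul {v : L2T d} (hv : v ∈ FunctionSpaces.Torus.energySpace d) (m : ℕ)
    (x : UnitAddTorus d) :
    ∑ k ∈ freqBall₀ m, ∑ j, ∑ c,
        (∫ y, ⟪(v : UnitAddTorus d → EuclideanSpace ℝ d) y, frameField k j c y⟫_ℝ) •
          frameField k j c x =
      FunctionSpaces.Torus.fourierTruncate m (v : UnitAddTorus d → EuclideanSpace ℝ d) x := by
  have hmem : MemLp (v : UnitAddTorus d → EuclideanSpace ℝ d) 2 volume := Lp.memLp v
  have hint : Integrable (v : UnitAddTorus d → EuclideanSpace ℝ d) volume :=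
    hmem.integrable one_le_two
  have hdiv := isWeaklyDivFree_of_mem_energySpace hv
  have key : ∀ k ∈ freqBall₀ m, ∑ j, ∑ c,
      (∫ y, ⟪(v : UnitAddTorus d → EuclideanSpace ℝ d) y, frameField k j c y⟫_ℝ) •
        frameField k j c x =
      FunctionSpaces.EuclideanSpace.realPart (mFourier k x •
        mFourierCoeff (FunctionSpaces.EuclideanSpace.complexify ∘ (v : UnitAddTorus d → EuclideanSpace ℝ d))
          k) := by
    intro k _
    simp_rw [frameField, FunctionSpaces.Torus.integral_inner_realTrigPoly_singleton hint, FunctionSpaces.Torus.realTrigPoly_singleton_apply,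
      smul_realPart_mFourier_smul, ← map_sum, ← Finset.smul_sum]
    rw [sum_sum_re_inner_frameVec_smul (hdiv.sum_mul_mFourierCoeff_eq_zero hmem k)]
  rw [Finset.sum_congr rfl key, freqBall₀, Finset.sum_erase _ (by
    rw [mFourierCoeff_complexify_coe_zero_of_mem hv, smul_zero, map_zero]),
    FunctionSpaces.Torus.fourierTruncate_eq, FunctionSpaces.Torus.realTrigPoly_apply_eq_sum]

/-- **Parseval identity of the frame**: for `v ∈ H`,
`∑_{0<|k|≤m} ∑ⱼ ∑_c (v, g_{kjc})² = ∫ ‖P_m v‖²`. [folklore] -/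
theorem sum_integral_inner_frameField_sq {v : L2T d} (hv : v ∈ FunctionSpaces.Torus.energySpace d) (m : ℕ) :
    ∑ k ∈ freqBall₀ m, ∑ j, ∑ c,
        (∫ y, ⟪(v : UnitAddTorus d → EuclideanSpace ℝ d) y, frameField k j c y⟫_ℝ) ^ 2 =
      ∫ y, ‖FunctionSpaces.Torus.fourierTruncate m (v : UnitAddTorus d → EuclideanSpace ℝ d) y‖ ^ 2 := by
  have hmem : MemLp (v : UnitAddTorus d → EuclideanSpace ℝ d) 2 volume := Lp.memLp v
  have hint : Integrable (v : UnitAddTorus d → EuclideanSpace ℝ d) volume :=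
    hmem.integrable one_le_two
  have hdiv := isWeaklyDivFree_of_mem_energySpace hv
  have key : ∀ k ∈ freqBall₀ m, ∑ j, ∑ c,
      (∫ y, ⟪(v : UnitAddTorus d → EuclideanSpace ℝ d) y, frameField k j c y⟫_ℝ) ^ 2 =
      ‖mFourierCoeff (FunctionSpaces.EuclideanSpace.complexify ∘ (v : UnitAddTorus d → EuclideanSpace ℝ d))
        k‖ ^ 2 := by
    intro k _
    simp_rw [frameField, FunctionSpaces.Torus.integral_inner_realTrigPoly_singleton hint]
    exact sum_sum_sq_re_inner_frameVec (hdiv.sum_mul_mFourierCoeff_eq_zero hmem k)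
  rw [Finset.sum_congr rfl key, freqBall₀, Finset.sum_erase _ (by
    rw [mFourierCoeff_complexify_coe_zero_of_mem hv, norm_zero, zero_pow two_ne_zero]),
    FunctionSpaces.Torus.integral_norm_sq_fourierTruncate hint]

end FrameField


/-! ### The Galerkin cylindrical test functional -/

section GalerkinTest

variable (d) in
/-- The index type of the Galerkin frame of order `m`. [folklore] -/
abbrev FrameIdx (m : ℕ) : Type _ := ↥(freqBall₀ (d := d) m) × d × Bool

/-- The frame field attached to an index. [folklore] -/
def frameFieldIdx (m : ℕ) (p : FrameIdx d m) : UnitAddTorus d → EuclideanSpace ℝ d :=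
  frameField (p.1 : d → ℤ) p.2.1 p.2.2

/-- Frequencies in `freqBall₀ m` are non-zero. [folklore] -/
theorem ne_zero_of_mem_freqBall₀ {m : ℕ} (k : ↥(freqBall₀ (d := d) m)) : (k : d → ℤ) ≠ 0 :=
  (Finset.mem_erase.1 k.2).1

/-- A fixed smooth bump `χ` on `ℝ`: `χ = 1` on `[-1, 1]`, `0 ≤ χ ≤ 1`, `χ = 0` outside `(-2, 2)`.
[folklore] -/
def galerkinCutoff : ContDiffBump (0 : ℝ) := ⟨1, 2, one_pos, one_lt_two⟩

/-- The weight `w(t) = χ(t) + t χ'(t) = (t χ(t))'`. [folklore] -/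
def galerkinWeight (t : ℝ) : ℝ :=
  galerkinCutoff t + t * deriv (galerkinCutoff : ℝ → ℝ) t

/-- The radial profile `ρ_a(s) = s χ(s / a)`: equal to `s` for `|s| ≤ a`, zero for `|s| ≥ 2a`
(`a > 0`). [folklore] -/
def galerkinRho (a s : ℝ) : ℝ := s * galerkinCutoff (s / a)

/-- `ρ_a' (s) = w(s / a)`. [folklore] -/
theorem hasDerivAt_galerkinRho (a s : ℝ) :
    HasDerivAt (galerkinRho a) (galerkinWeight (s / a)) s := by
  have h1 : HasDerivAt (galerkinCutoff : ℝ → ℝ) (deriv (galerkinCutoff : ℝ → ℝ) (s / a)) (s / a) :=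
    (((galerkinCutoff.contDiff (n := 1)).differentiable (by simp)) _).hasDerivAt
  have h2 : HasDerivAt (fun s : ℝ => s / a) (1 / a) s := by
    simpa using (hasDerivAt_id s).div_const a
  have h3 := (hasDerivAt_id s).mul (h1.comp s h2)
  have h4 : galerkinWeight (s / a) =
      1 * ((galerkinCutoff : ℝ → ℝ) ∘ fun s : ℝ => s / a) s +
        id s * (deriv (galerkinCutoff : ℝ → ℝ) (s / a) * (1 / a)) := by
    simp only [galerkinWeight, Function.comp_apply, id_eq, one_mul]
    ring
  rw [h4]
  exact h3

/-- `w` is continuous. [folklore] -/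
theorem continuous_galerkinWeight : Continuous galerkinWeight :=
  galerkinCutoff.continuous.add
    (continuous_id.mul (galerkinCutoff.contDiff (n := 1)).continuous_deriv_one)

/-- `w = 1` on `[-1, 1]`. [folklore] -/
theorem galerkinWeight_eq_one {t : ℝ} (ht : |t| ≤ 1) : galerkinWeight t = 1 := by
  have h1 : (galerkinCutoff : ℝ → ℝ) t = 1 :=
    galerkinCutoff.one_of_mem_closedBall (by simpa [galerkinCutoff] using ht)
  have h2 : deriv (galerkinCutoff : ℝ → ℝ) t = 0 := by
    refine IsLocalMax.deriv_eq_zero ?_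
    filter_upwards with s
    rw [h1]
    exact galerkinCutoff.le_one
  rw [galerkinWeight, h1, h2, mul_zero, add_zero]

/-- `w(0) = 1`. [folklore] -/
theorem galerkinWeight_zero : galerkinWeight 0 = 1 :=
  galerkinWeight_eq_one (by simp)

/-- `w = 0` outside `(-2, 2)`. [folklore] -/
theorem galerkinWeight_eq_zero {t : ℝ} (ht : 2 ≤ |t|) : galerkinWeight t = 0 := by
  have h1 : (galerkinCutoff : ℝ → ℝ) t = 0 :=
    galerkinCutoff.zero_of_le_dist (by simpa [galerkinCutoff, Real.dist_eq] using ht)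
  have h2 : deriv (galerkinCutoff : ℝ → ℝ) t = 0 := by
    refine IsLocalMin.deriv_eq_zero ?_
    filter_upwards with s
    rw [h1]
    exact galerkinCutoff.nonneg
  rw [galerkinWeight, h1, h2, mul_zero, add_zero]

/-- `w` is bounded: `|w| ≤ C_w`. [folklore] -/
theorem exists_abs_galerkinWeight_le : ∃ C : ℝ, 1 ≤ C ∧ ∀ t, |galerkinWeight t| ≤ C := by
  obtain ⟨C, hC⟩ := (isCompact_Icc (a := (-2 : ℝ)) (b := 2)).exists_bound_of_continuousOn
    continuous_galerkinWeight.continuousOn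
  have h0 : (1 : ℝ) ≤ C := by
    have := hC 0 (by norm_num)
    rwa [galerkinWeight_zero, norm_one] at this
  refine ⟨C, h0, fun t => ?_⟩
  by_cases ht : |t| ≤ 2
  · rw [← Real.norm_eq_abs]
    exact hC t (by constructor <;> linarith [abs_le.1 ht])
  · rw [galerkinWeight_eq_zero (le_of_lt (not_le.1 ht)), abs_zero]
    linarith

/-- The Galerkin profile `φ(ξ) = ρ_a(‖ξ‖²)` on `ℝ^n`. [folklore] -/
def galerkinProfile (n : ℕ) (a : ℝ) : EuclideanSpace ℝ (Fin n) → ℝ :=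
  fun ξ => galerkinRho a (‖ξ‖ ^ 2)

/-- The profile is `C¹`. [folklore] -/
theorem contDiff_galerkinProfile (n : ℕ) (a : ℝ) : ContDiff ℝ 1 (galerkinProfile n a) := by
  have hρ : ContDiff ℝ 1 (galerkinRho a) := by
    have : galerkinRho a = fun s => s * (galerkinCutoff : ℝ → ℝ) (s / a) := rfl
    rw [this]
    exact contDiff_id.mul ((galerkinCutoff.contDiff (n := 1)).comp (contDiff_id.div_const a))
  exact hρ.comp (contDiff_norm_sq ℝ)

/-- The profile has compact support (`a > 0`). [folklore] -/
theorem hasCompactSupport_galerkinProfile (n : ℕ) {a : ℝ} (ha : 0 < a) :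
    HasCompactSupport (galerkinProfile n a) := by
  refine HasCompactSupport.intro (isCompact_closedBall (0 : EuclideanSpace ℝ (Fin n))
    (Real.sqrt (2 * a))) fun ξ hξ => ?_
  rw [Metric.mem_closedBall, dist_zero_right, not_le] at hξ
  have h2 : 2 * a < ‖ξ‖ ^ 2 := (Real.sqrt_lt' ((Real.sqrt_nonneg _).trans_lt hξ)).1 hξ
  have h3 : galerkinCutoff.rOut ≤ dist (‖ξ‖ ^ 2 / a) 0 := by
    rw [Real.dist_eq, sub_zero, abs_of_nonneg (by positivity)]
    show (2 : ℝ) ≤ ‖ξ‖ ^ 2 / a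
    rw [le_div_iff₀ ha]
    linarith
  rw [galerkinProfile, galerkinRho, galerkinCutoff.zero_of_le_dist h3, mul_zero]

/-- The derivative of the profile: `∂ᵢ φ(ξ) = 2 w(‖ξ‖²/a) ξᵢ`. [folklore] -/
theorem fderiv_galerkinProfile_single {n : ℕ} (a : ℝ) (ξ : EuclideanSpace ℝ (Fin n)) (i : Fin n) :
    _root_.fderiv ℝ (galerkinProfile n a) ξ (EuclideanSpace.single i 1) =
      2 * galerkinWeight (‖ξ‖ ^ 2 / a) * ξ i := by
  have h := (hasDerivAt_galerkinRho a (‖ξ‖ ^ 2)).comp_hasFDerivAt ξ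
    (hasStrictFDerivAt_norm_sq ξ).hasFDerivAt
  rw [show galerkinProfile n a = galerkinRho a ∘ fun x : EuclideanSpace ℝ (Fin n) => ‖x‖ ^ 2
      from rfl, h.fderiv]
  simp [innerSL_apply_apply, EuclideanSpace.inner_single_right]
  ring

/-- **The Galerkin cylindrical test functional** of order `m` and level `a > 0`:
coordinates `(u, g_p)` over the frame `g_p`, `p ∈ FrameIdx d m`, and radial profile
`φ(ξ) = ρ_a(|ξ|²) = |ξ|² χ(|ξ|²/a)`, so that `Φ(u) = ρ_a(|P_m u|²)` and, for *every* `u ∈ H`,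
`Φ'(u) = 2 w(|P_m u|²/a) P_m u` with the bounded weight `w = ρ₁'` (`w = 1` near `0`)
(FMRT 2001, Ch. IV §1.2, p. 197: the example `Φ(u) = ρ(|P_m u|²)`, `Φ'(u) = 2ρ'(|P_m u|²) P_m u`).
[cite: FMRT2001, Ch. IV §1.2 (example after Def. 1.2), p. 197] -/
def galerkinTest (m : ℕ) {a : ℝ} (ha : 0 < a) : CylindricalTest d where
  m := Fintype.card (FrameIdx d m)
  g i := frameFieldIdx m ((Fintype.equivFin (FrameIdx d m)).symm i)
  g_smooth _ := FunctionSpaces.Torus.isSmooth_realTrigPoly _ _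
  g_divFree _ := isDivFree_frameField (ne_zero_of_mem_freqBall₀ _) _ _
  g_zeroMean _ := integral_frameField (ne_zero_of_mem_freqBall₀ _) _ _
  φ := galerkinProfile _ a
  φ_contDiff := contDiff_galerkinProfile _ a
  φ_compact := hasCompactSupport_galerkinProfile _ ha

/-- The coordinates of the Galerkin functional are the pairings with the frame fields. [folklore] -/
theorem galerkinTest_coords_apply (m : ℕ) {a : ℝ} (ha : 0 < a) (u : FunctionSpaces.Torus.energySpace d)
    (i : Fin (galerkinTest (d := d) m ha).m) :
    (galerkinTest m ha).coords u i =
      pairing (u : L2T d) (frameFieldIdx m ((Fintype.equivFin (FrameIdx d m)).symm i)) :=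
  rfl

/-- Sums over the coordinates of the Galerkin functional are sums over the frame. [folklore] -/
theorem sum_galerkinTest_eq {M : Type*} [AddCommMonoid M] (m : ℕ) {a : ℝ} (ha : 0 < a)
    (F : (UnitAddTorus d → EuclideanSpace ℝ d) → M) :
    ∑ i : Fin (galerkinTest (d := d) m ha).m, F ((galerkinTest m ha).g i) =
      ∑ k ∈ freqBall₀ m, ∑ j, ∑ c, F (frameField k j c) := by
  have h1 : ∑ i : Fin (galerkinTest (d := d) m ha).m, F ((galerkinTest m ha).g i) =
      ∑ p : FrameIdx d m, F (frameFieldIdx m p) :=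
    Fintype.sum_equiv (Fintype.equivFin (FrameIdx d m)).symm _ _ fun _ => rfl
  rw [h1, Fintype.sum_prod_type, ← Finset.sum_coe_sort (freqBall₀ m)]
  refine Finset.sum_congr rfl fun k _ => ?_
  rw [Fintype.sum_prod_type]
  rfl

/-- `‖coords u‖² = ∫ ‖P_m u‖²` for the Galerkin functional. [folklore] -/
theorem norm_sq_galerkinTest_coords (m : ℕ) {a : ℝ} (ha : 0 < a) (u : FunctionSpaces.Torus.energySpace d) :
    ‖(galerkinTest m ha).coords u‖ ^ 2 =
      ∫ y, ‖FunctionSpaces.Torus.fourierTruncate m (((u : L2T d)) : UnitAddTorus d → EuclideanSpace ℝ d) y‖ ^ 2 := by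
  rw [EuclideanSpace.real_norm_sq_eq, ← sum_integral_inner_frameField_sq u.2 m]
  exact sum_galerkinTest_eq m ha (fun g => (pairing (u : L2T d) g) ^ 2)

/-- **The differential of the Galerkin functional is `2 w(|P_m u|²/a) P_m u`** for every `u ∈ H`
(FMRT 2001, Ch. IV §1.2, p. 197: `Φ'(u) = 2ρ'(|P_m u|²) P_m u`).
[cite: FMRT2001, Ch. IV §1.2 (example after Def. 1.2), p. 197] -/
theorem grad_galerkinTest {m : ℕ} {a : ℝ} (ha : 0 < a) (u : FunctionSpaces.Torus.energySpace d) :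
    (galerkinTest m ha).grad u =
      fun x =>
        (2 * galerkinWeight
          ((∫ y, ‖FunctionSpaces.Torus.fourierTruncate m (((u : L2T d)) : UnitAddTorus d → EuclideanSpace ℝ d) y‖ ^ 2) /
            a)) •
          FunctionSpaces.Torus.fourierTruncate m (((u : L2T d)) : UnitAddTorus d → EuclideanSpace ℝ d) x := by
  set c : ℝ := 2 * galerkinWeight
    ((∫ y, ‖FunctionSpaces.Torus.fourierTruncate m (((u : L2T d)) : UnitAddTorus d → EuclideanSpace ℝ d) y‖ ^ 2) / a)
    with hc
  have hderiv : ∀ i, _root_.fderiv ℝ (galerkinProfile _ a) ((galerkinTest m ha).coords u)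
      (EuclideanSpace.single i 1) = c * (galerkinTest m ha).coords u i := by
    intro i
    rw [fderiv_galerkinProfile_single, norm_sq_galerkinTest_coords]
  funext x
  have hsum : ∑ i, (galerkinTest m ha).coords u i • (galerkinTest m ha).g i x =
      ∑ k ∈ freqBall₀ m, ∑ j, ∑ c, pairing (u : L2T d) (frameField k j c) • frameField k j c x :=
    sum_galerkinTest_eq m ha (fun g => pairing (u : L2T d) g • g x)
  change ∑ i, (_root_.fderiv ℝ (galerkinProfile _ a) ((galerkinTest m ha).coords u)
    (EuclideanSpace.single i 1)) • (galerkinTest m ha).g i x = _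
  simp_rw [hderiv, mul_smul, ← Finset.smul_sum]
  rw [hsum]
  exact congrArg _ (sum_integral_inner_frameField_smul u.2 m x)

end GalerkinTest


/-! ### The Navier–Stokes generator on Galerkin truncations -/

section Generator

/-- **The Stokes term on a truncation**: `(u, Δ P_m u) = -‖∇ P_m u‖₂²` for `u ∈ L²`
(FMRT 2001, Ch. IV §1.1, `(Au, v) = ((u, v))`, with `P_m` self-adjoint and commuting with `A`).
[cite: FMRT2001, Ch. IV (1.10), p. 192] -/
theorem integral_inner_laplacian_fourierTruncate {v : UnitAddTorus d → EuclideanSpace ℝ d}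
    (hv : Integrable v volume) (m : ℕ) :
    ∫ x, ⟪v x, FunctionSpaces.Torus.laplacian (FunctionSpaces.Torus.fourierTruncate m v) x⟫_ℝ =
      -(FunctionSpaces.Torus.eGradNormSq (FunctionSpaces.Torus.fourierTruncate m v)).toReal := by
  have hlap : FunctionSpaces.Torus.laplacian (FunctionSpaces.Torus.fourierTruncate m v) = FunctionSpaces.Torus.realTrigPoly (FunctionSpaces.Torus.freqBall m) (fun k =>
      -(((4 * Real.pi ^ 2 * FunctionSpaces.Torus.freqNormSq k : ℝ) : ℂ) •
        mFourierCoeff (FunctionSpaces.EuclideanSpace.complexify ∘ v) k)) :=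
    funext fun x => FunctionSpaces.Torus.laplacian_realTrigPoly _ _ x
  rw [hlap, FunctionSpaces.Torus.integral_inner_realTrigPoly_of_integrable _ _ hv, FunctionSpaces.Torus.fourierTruncate_eq,
    FunctionSpaces.Torus.toReal_eGradNormSq_realTrigPoly FunctionSpaces.Torus.neg_mem_freqBall_of_mem (FunctionSpaces.Torus.isConjSymm_mFourierCoeff hv),
    Finset.mul_sum, ← Finset.sum_neg_distrib]
  refine Finset.sum_congr rfl fun k _ => ?_
  have hW : (inner ℂ (mFourierCoeff (FunctionSpaces.EuclideanSpace.complexify ∘ v) k)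
      (mFourierCoeff (FunctionSpaces.EuclideanSpace.complexify ∘ v) k)).re =
      ‖mFourierCoeff (FunctionSpaces.EuclideanSpace.complexify ∘ v) k‖ ^ 2 := by
    have := inner_self_eq_norm_sq (𝕜 := ℂ) (mFourierCoeff (FunctionSpaces.EuclideanSpace.complexify ∘ v) k)
    simpa using this
  rw [inner_neg_right, inner_smul_right, Complex.neg_re, Complex.mul_re, Complex.ofReal_re,
    Complex.ofReal_im, zero_mul, sub_zero, hW]
  ring

/-- **The generator tested against a multiple of a truncation**:
`⟨F(u), c P_m u⟩ = c ((f, P_m u) − ν ‖∇P_m u‖² + ∫ (u ⊗ u) : ∇P_m u)` (FMRT 2001, Ch. IV (1.11)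
with `v = P_m u`: `(F(u), v) = (f, v) − ν((u, v)) − b(u, u, v)`).
[cite: FMRT2001, Ch. IV (1.11), p. 193] -/
theorem nsGeneratorPairing_smul_fourierTruncate (ν : ℝ) (f : UnitAddTorus d → EuclideanSpace ℝ d)
    (u : FunctionSpaces.Torus.energySpace d) (c : ℝ) (m : ℕ) :
    nsGeneratorPairing ν f u
        (fun x => c • FunctionSpaces.Torus.fourierTruncate m (((u : L2T d)) : UnitAddTorus d → EuclideanSpace ℝ d) x) =
      c * ((∫ x,
          ⟪f x, FunctionSpaces.Torus.fourierTruncate m (((u : L2T d)) : UnitAddTorus d → EuclideanSpace ℝ d) x⟫_ℝ) -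
        ν * (FunctionSpaces.Torus.eGradNormSq (FunctionSpaces.Torus.fourierTruncate m
          (((u : L2T d)) : UnitAddTorus d → EuclideanSpace ℝ d))).toReal +
        inertialPairing (u : L2T d)
          (FunctionSpaces.Torus.fourierTruncate m (((u : L2T d)) : UnitAddTorus d → EuclideanSpace ℝ d))) := by
  rw [nsGeneratorPairing, inertialPairing, inertialPairing]
  set v : UnitAddTorus d → EuclideanSpace ℝ d := ((u : L2T d) : UnitAddTorus d → EuclideanSpace ℝ d)
    with hv
  have hint : Integrable v volume := (Lp.memLp (u : L2T d)).integrable one_le_two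
  have hw : FunctionSpaces.Torus.IsSmooth (FunctionSpaces.Torus.fourierTruncate m v) := FunctionSpaces.Torus.isSmooth_fourierTruncate m v
  -- the Laplacian is homogeneous: `Δ(c w) = c Δw` for the smooth field `w = P_m v`
  have hlap : ∀ x, FunctionSpaces.Torus.laplacian (fun y => c • FunctionSpaces.Torus.fourierTruncate m v y) x =
      c • FunctionSpaces.Torus.laplacian (FunctionSpaces.Torus.fourierTruncate m v) x := by
    intro x
    have hcw : FunctionSpaces.Torus.IsSmooth (fun y => c • FunctionSpaces.Torus.fourierTruncate m v y) := hw.const_smul c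
    rw [FunctionSpaces.Torus.laplacian_eq_sum_partialDeriv_partialDeriv hcw,
      FunctionSpaces.Torus.laplacian_eq_sum_partialDeriv_partialDeriv hw, Finset.smul_sum]
    refine Finset.sum_congr rfl fun i _ => ?_
    have h1 : FunctionSpaces.Torus.partialDeriv i (fun y => c • FunctionSpaces.Torus.fourierTruncate m v y) =
        c • FunctionSpaces.Torus.partialDeriv i (FunctionSpaces.Torus.fourierTruncate m v) :=
      FunctionSpaces.Torus.partialDeriv_const_smul (hw.isContDiff (by simp)) c i
    rw [h1, FunctionSpaces.Torus.partialDeriv_const_smul ((hw.partialDeriv i).isContDiff (by simp)) c i, Pi.smul_apply]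
  simp_rw [hlap, real_inner_smul_right, integral_const_mul]
  have hfd : ∀ x a, FunctionSpaces.Torus.fderiv (fun y => c • FunctionSpaces.Torus.fourierTruncate m v y) x a =
      c • FunctionSpaces.Torus.fderiv (FunctionSpaces.Torus.fourierTruncate m v) x a := by
    intro x a
    have h := FunctionSpaces.Torus.fderiv_const_smul (hw.isContDiff (by simp)) c x
    rw [show (c • FunctionSpaces.Torus.fourierTruncate m v) = fun y => c • FunctionSpaces.Torus.fourierTruncate m v y from rfl] at h
    rw [h]
    rfl
  simp_rw [hfd, real_inner_smul_left, integral_const_mul,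
    integral_inner_laplacian_fourierTruncate hint]
  ring

end Generator


/-! ### Spectral bounds for the truncation and its tail -/

section Spectral

omit [DecidableEq d] in
/-- For an `L²` field, `ofReal (∫ ‖h‖²) = ∫⁻ ‖h‖ₑ²`. [folklore] -/
theorem ofReal_integral_norm_sq_eq_lintegral {h : UnitAddTorus d → EuclideanSpace ℝ d}
    (hh : MemLp h 2 volume) : ENNReal.ofReal (∫ x, ‖h x‖ ^ 2) = ∫⁻ x, ‖h x‖ₑ ^ 2 := by
  rw [ofReal_integral_eq_lintegral_ofReal (hh.integrable_norm_pow two_ne_zero)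
    (ae_of_all _ fun x => by positivity)]
  refine lintegral_congr fun x => ?_
  rw [← ofReal_norm, ← ENNReal.ofReal_pow (norm_nonneg _)]

/-- **Lattice point count**: `#{k ∈ ℤ^d : |k|² ≤ m²} ≤ (2m+1)^d`. [folklore] -/
theorem card_freqBall_le (m : ℕ) : (FunctionSpaces.Torus.freqBall (d := d) m).card ≤ (2 * m + 1) ^ Fintype.card d := by
  rw [FunctionSpaces.Torus.freqBall]
  refine (Finset.card_filter_le _ _).trans ?_
  rw [Fintype.card_piFinset, Finset.prod_const, Finset.card_univ]
  gcongr
  rw [Int.card_Icc]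
  omega

omit [DecidableEq d] in
/-- Outside the ball of radius `m` the frequencies satisfy `m² + 1 ≤ |k|²` (integrality).
[folklore] -/
theorem sq_add_one_le_freqNormSq_of_not_mem [DecidableEq d] {m : ℕ} {k : d → ℤ}
    (hk : k ∉ FunctionSpaces.Torus.freqBall m) : (m : ℝ) ^ 2 + 1 ≤ FunctionSpaces.Torus.freqNormSq k := by
  rw [FunctionSpaces.Torus.not_mem_freqBall] at hk
  have hZ : FunctionSpaces.Torus.freqNormSq k = ((∑ i, (k i) ^ 2 : ℤ) : ℝ) := by
    rw [FunctionSpaces.Torus.freqNormSq]; push_cast; rfl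
  rw [hZ] at hk ⊢
  have h1 : ((m : ℤ) : ℝ) ^ 2 < ((∑ i, (k i) ^ 2 : ℤ) : ℝ) := by exact_mod_cast hk
  have h2 : (m : ℤ) ^ 2 < ∑ i, (k i) ^ 2 := by exact_mod_cast h1
  have h3 : (m : ℤ) ^ 2 + 1 ≤ ∑ i, (k i) ^ 2 := h2
  exact_mod_cast h3

/-- The enstrophy does not increase under truncation: `‖∇P_m v‖₂² ≤ ‖∇v‖₂²`. [folklore] -/
theorem eGradNormSq_fourierTruncate_le {v : UnitAddTorus d → EuclideanSpace ℝ d}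
    (hv : Integrable v volume) (m : ℕ) : FunctionSpaces.Torus.eGradNormSq (FunctionSpaces.Torus.fourierTruncate m v) ≤ FunctionSpaces.Torus.eGradNormSq v := by
  rw [FunctionSpaces.Torus.eGradNormSq_eq_tsum, FunctionSpaces.Torus.eGradNormSq_eq_tsum]
  refine mul_le_mul_right (ENNReal.tsum_le_tsum fun k => ?_) _
  rw [FunctionSpaces.Torus.mFourierCoeff_fourierTruncate hv]
  split_ifs
  · exact le_rfl
  · simp

/-- **The tail enstrophy** beyond the ball of radius `m`: `4π² ∑_{|k|>m} |k|² ‖v̂(k)‖²`.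
[folklore] -/
def tailGradNormSq (m : ℕ) (v : UnitAddTorus d → EuclideanSpace ℝ d) : ℝ≥0∞ :=
  ENNReal.ofReal (4 * Real.pi ^ 2) *
    ∑' k : {k : d → ℤ // k ∉ FunctionSpaces.Torus.freqBall m}, ENNReal.ofReal (FunctionSpaces.Torus.freqNormSq (k : d → ℤ)) *
      ‖mFourierCoeff (FunctionSpaces.EuclideanSpace.complexify ∘ v) (k : d → ℤ)‖ₑ ^ 2

/-- The tail enstrophy is at most the enstrophy. [folklore] -/
theorem tailGradNormSq_le (m : ℕ) (v : UnitAddTorus d → EuclideanSpace ℝ d) :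
    tailGradNormSq m v ≤ FunctionSpaces.Torus.eGradNormSq v := by
  rw [tailGradNormSq, FunctionSpaces.Torus.eGradNormSq_eq_tsum]
  exact mul_le_mul_right (ENNReal.tsum_comp_le_tsum_of_injective Subtype.val_injective _) _

/-- The tail enstrophy of a finite-enstrophy field tends to zero. [folklore] -/
theorem tendsto_tailGradNormSq {v : UnitAddTorus d → EuclideanSpace ℝ d} (hv : FunctionSpaces.Torus.eGradNormSq v ≠ ⊤) :
    Tendsto (fun m => tailGradNormSq m v) atTop (𝓝 0) := by
  have hfin : ∑' k : d → ℤ, ENNReal.ofReal (FunctionSpaces.Torus.freqNormSq k) *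
      ‖mFourierCoeff (FunctionSpaces.EuclideanSpace.complexify ∘ v) k‖ₑ ^ 2 ≠ ⊤ := by
    intro h
    rw [FunctionSpaces.Torus.eGradNormSq_eq_tsum, h, ENNReal.mul_top (by positivity)] at hv
    exact hv rfl
  have h := (ENNReal.tendsto_tsum_compl_atTop_zero hfin).comp FunctionSpaces.Torus.tendsto_freqBall_atTop
  have h2 := ENNReal.Tendsto.const_mul (a := ENNReal.ofReal (4 * Real.pi ^ 2)) h
    (Or.inr ENNReal.ofReal_ne_top)
  rw [mul_zero] at h2
  exact h2

/-- **Spectral gap of the tail**: `4π² (m²+1) ∫⁻ ‖P_m v - v‖ₑ² ≤ tailGradNormSq m v`. [folklore] -/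
theorem lintegral_enorm_sq_fourierTruncate_sub_le {v : UnitAddTorus d → EuclideanSpace ℝ d}
    (hv : MemLp v 2 volume) (m : ℕ) :
    ENNReal.ofReal (4 * Real.pi ^ 2) * ENNReal.ofReal ((m : ℝ) ^ 2 + 1) *
        ∫⁻ x, ‖FunctionSpaces.Torus.fourierTruncate m v x - v x‖ₑ ^ 2 ≤
      tailGradNormSq m v := by
  rw [FunctionSpaces.Torus.lintegral_enorm_sq_fourierTruncate_sub hv, tailGradNormSq, mul_assoc, ← ENNReal.tsum_mul_left]
  refine mul_le_mul_right (ENNReal.tsum_le_tsum fun k => ?_) _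
  exact mul_le_mul_left (ENNReal.ofReal_le_ofReal (sq_add_one_le_freqNormSq_of_not_mem k.2)) _

/-- Real form of the spectral gap: `∫ ‖P_m v - v‖² ≤ tail / (4π²(m²+1))`. [folklore] -/
theorem integral_norm_sq_fourierTruncate_sub_le {v : UnitAddTorus d → EuclideanSpace ℝ d}
    (hv : MemLp v 2 volume) (m : ℕ) (htail : tailGradNormSq m v ≠ ⊤) :
    ∫ x, ‖FunctionSpaces.Torus.fourierTruncate m v x - v x‖ ^ 2 ≤
      (tailGradNormSq m v).toReal / (4 * Real.pi ^ 2 * ((m : ℝ) ^ 2 + 1)) := by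
  have hsub : MemLp (fun x => FunctionSpaces.Torus.fourierTruncate m v x - v x) 2 volume :=
    (FunctionSpaces.Torus.memLp_fourierTruncate m v 2).sub hv
  have h := lintegral_enorm_sq_fourierTruncate_sub_le hv m
  rw [← ofReal_integral_norm_sq_eq_lintegral hsub, ← ENNReal.ofReal_mul (by positivity),
    ← ENNReal.ofReal_mul (by positivity), ENNReal.ofReal_le_iff_le_toReal htail] at h
  rw [le_div_iff₀ (by positivity)]
  linarith

/-- **The derivative bound of a truncation**: `‖D(P_m v)(x) a‖ ≤ ‖a‖ K_m(v)` with
`K_m(v) = ∑ᵢ ∑_{|k|≤m} 2π |kᵢ| ‖v̂(k)‖`. [folklore] -/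
def truncDerivBound (m : ℕ) (v : UnitAddTorus d → EuclideanSpace ℝ d) : ℝ :=
  ∑ i : d, ∑ k ∈ FunctionSpaces.Torus.freqBall m,
    2 * Real.pi * |(k i : ℝ)| * ‖mFourierCoeff (FunctionSpaces.EuclideanSpace.complexify ∘ v) k‖

/-- `K_m(v) ≥ 0`. [folklore] -/
theorem truncDerivBound_nonneg (m : ℕ) (v : UnitAddTorus d → EuclideanSpace ℝ d) :
    0 ≤ truncDerivBound m v :=
  Finset.sum_nonneg fun _ _ => Finset.sum_nonneg fun _ _ => by positivity

/-- `‖D(P_m v)(x) a‖ ≤ ‖a‖ K_m(v)` (expand in partial derivatives and bound the modes).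
[folklore] -/
theorem norm_fderiv_fourierTruncate_apply_le (m : ℕ) (v : UnitAddTorus d → EuclideanSpace ℝ d)
    (x : UnitAddTorus d) (a : EuclideanSpace ℝ d) :
    ‖FunctionSpaces.Torus.fderiv (FunctionSpaces.Torus.fourierTruncate m v) x a‖ ≤ ‖a‖ * truncDerivBound m v := by
  refine (FunctionSpaces.Torus.norm_fderiv_apply_le ((FunctionSpaces.Torus.isSmooth_fourierTruncate m v).isContDiff (by simp)) x a).trans ?_
  refine mul_le_mul_of_nonneg_left (Finset.sum_le_sum fun i _ => ?_) (norm_nonneg _)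
  exact FunctionSpaces.Torus.norm_partialDeriv_realTrigPoly_le _ _ i x

/-- **Bernstein-type bound in dimension two**: `K_m(v)² ≤ 4 #{|k| ≤ m} ‖∇P_m v‖₂²`. [folklore] -/
theorem truncDerivBound_sq_le (hd : Fintype.card d = 2) {v : UnitAddTorus d → EuclideanSpace ℝ d}
    (hv : Integrable v volume) (m : ℕ) :
    (truncDerivBound m v) ^ 2 ≤
      4 * (FunctionSpaces.Torus.freqBall (d := d) m).card * (FunctionSpaces.Torus.eGradNormSq (FunctionSpaces.Torus.fourierTruncate m v)).toReal := by
  set S : ℝ := ∑ k ∈ FunctionSpaces.Torus.freqBall m, 2 * Real.pi * Real.sqrt (FunctionSpaces.Torus.freqNormSq k) *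
    ‖mFourierCoeff (FunctionSpaces.EuclideanSpace.complexify ∘ v) k‖ with hS
  have hS0 : 0 ≤ S := Finset.sum_nonneg fun _ _ => by positivity
  have hK : truncDerivBound m v ≤ 2 * S := by
    have h1 : truncDerivBound m v ≤ ∑ _i : d, S := by
      refine Finset.sum_le_sum fun i _ => Finset.sum_le_sum fun k _ => ?_
      gcongr
      exact FunctionSpaces.Torus.abs_apply_le_sqrt_freqNormSq k i
    rw [Finset.sum_const, Finset.card_univ, hd, nsmul_eq_mul] at h1
    simpa using h1
  have hS2 : S ^ 2 ≤ (FunctionSpaces.Torus.freqBall (d := d) m).card * (FunctionSpaces.Torus.eGradNormSq (FunctionSpaces.Torus.fourierTruncate m v)).toReal := by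
    have hcs := Finset.sum_mul_sq_le_sq_mul_sq (FunctionSpaces.Torus.freqBall m)
      (fun k => 2 * Real.pi * Real.sqrt (FunctionSpaces.Torus.freqNormSq k) *
        ‖mFourierCoeff (FunctionSpaces.EuclideanSpace.complexify ∘ v) k‖) (fun _ => (1 : ℝ))
    simp only [mul_one, one_pow, Finset.sum_const, nsmul_eq_mul] at hcs
    refine hcs.trans ?_
    rw [FunctionSpaces.Torus.fourierTruncate_eq, FunctionSpaces.Torus.toReal_eGradNormSq_realTrigPoly FunctionSpaces.Torus.neg_mem_freqBall_of_mem
      (FunctionSpaces.Torus.isConjSymm_mFourierCoeff hv), Finset.mul_sum, Finset.mul_sum, Finset.sum_mul]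
    refine le_of_eq (Finset.sum_congr rfl fun k _ => ?_)
    rw [mul_pow, mul_pow, Real.sq_sqrt (FunctionSpaces.Torus.freqNormSq_nonneg k)]
    ring
  calc (truncDerivBound m v) ^ 2 ≤ (2 * S) ^ 2 :=
        pow_le_pow_left₀ (truncDerivBound_nonneg m v) hK 2
    _ = 4 * S ^ 2 := by ring
    _ ≤ 4 * ((FunctionSpaces.Torus.freqBall (d := d) m).card * (FunctionSpaces.Torus.eGradNormSq (FunctionSpaces.Torus.fourierTruncate m v)).toReal) := by
        gcongr
    _ = _ := by ring

/-- **Second Bernstein-type bound in dimension two**: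
`K_m(v)² ≤ 16π² m² #{|k| ≤ m} ∫ ‖P_m v‖²` (`|kᵢ| ≤ m` on the ball, Cauchy–Schwarz, and Parseval
for the truncation). [folklore] -/
theorem truncDerivBound_sq_le_integral (hd : Fintype.card d = 2)
    {v : UnitAddTorus d → EuclideanSpace ℝ d} (hv : Integrable v volume) (m : ℕ) :
    (truncDerivBound m v) ^ 2 ≤
      16 * Real.pi ^ 2 * (m : ℝ) ^ 2 * (FunctionSpaces.Torus.freqBall (d := d) m).card *
        ∫ x, ‖FunctionSpaces.Torus.fourierTruncate m v x‖ ^ 2 := by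
  set S : ℝ := ∑ k ∈ FunctionSpaces.Torus.freqBall m, ‖mFourierCoeff (FunctionSpaces.EuclideanSpace.complexify ∘ v) k‖ with hS
  have hS0 : 0 ≤ S := Finset.sum_nonneg fun _ _ => norm_nonneg _
  have hK : truncDerivBound m v ≤ 2 * (2 * Real.pi * m * S) := by
    have h1 : truncDerivBound m v ≤ ∑ _i : d, 2 * Real.pi * m * S := by
      refine Finset.sum_le_sum fun i _ => ?_
      rw [hS, Finset.mul_sum]
      refine Finset.sum_le_sum fun k hk => ?_
      have hki : |(k i : ℝ)| ≤ m := by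
        refine (FunctionSpaces.Torus.abs_apply_le_sqrt_freqNormSq k i).trans ?_
        refine (Real.sqrt_le_sqrt (FunctionSpaces.Torus.mem_freqBall.1 hk)).trans_eq ?_
        rw [Real.sqrt_sq (Nat.cast_nonneg _)]
      have hc : 0 ≤ ‖mFourierCoeff (FunctionSpaces.EuclideanSpace.complexify ∘ v) k‖ := norm_nonneg _
      have hπ : 0 ≤ 2 * Real.pi := by positivity
      calc 2 * Real.pi * |(k i : ℝ)| * ‖mFourierCoeff (FunctionSpaces.EuclideanSpace.complexify ∘ v) k‖
          = (2 * Real.pi) * (|(k i : ℝ)| * ‖mFourierCoeff (FunctionSpaces.EuclideanSpace.complexify ∘ v) k‖) := by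
            ring
        _ ≤ (2 * Real.pi) * ((m : ℝ) * ‖mFourierCoeff (FunctionSpaces.EuclideanSpace.complexify ∘ v) k‖) :=
            mul_le_mul_of_nonneg_left (mul_le_mul_of_nonneg_right hki hc) hπ
        _ = 2 * Real.pi * m * ‖mFourierCoeff (FunctionSpaces.EuclideanSpace.complexify ∘ v) k‖ := by ring
    rw [Finset.sum_const, Finset.card_univ, hd] at h1
    simpa [two_mul] using h1
  have hS2 : S ^ 2 ≤ (FunctionSpaces.Torus.freqBall (d := d) m).card * ∫ x, ‖FunctionSpaces.Torus.fourierTruncate m v x‖ ^ 2 := by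
    have hcs := Finset.sum_mul_sq_le_sq_mul_sq (FunctionSpaces.Torus.freqBall m)
      (fun k => ‖mFourierCoeff (FunctionSpaces.EuclideanSpace.complexify ∘ v) k‖) (fun _ => (1 : ℝ))
    simp only [mul_one, one_pow, Finset.sum_const, nsmul_eq_mul] at hcs
    rw [FunctionSpaces.Torus.integral_norm_sq_fourierTruncate hv, mul_comm]
    exact hcs
  have hK0 : 0 ≤ truncDerivBound m v := truncDerivBound_nonneg m v
  calc (truncDerivBound m v) ^ 2 ≤ (2 * (2 * Real.pi * m * S)) ^ 2 := pow_le_pow_left₀ hK0 hK 2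
    _ = 16 * Real.pi ^ 2 * (m : ℝ) ^ 2 * S ^ 2 := by ring
    _ ≤ 16 * Real.pi ^ 2 * (m : ℝ) ^ 2 *
          ((FunctionSpaces.Torus.freqBall (d := d) m).card * ∫ x, ‖FunctionSpaces.Torus.fourierTruncate m v x‖ ^ 2) := by gcongr
    _ = _ := by ring

end Spectral


/-! ### The inertial term on truncations in dimension two -/

section Inertial

omit [DecidableEq d] in
/-- `⟪Dw(x) a, w x⟫ = ½ ⟪a, ∇‖w‖²(x)⟫` for a `C¹` field `w`. [folklore] -/
theorem inner_fderiv_apply_self_eq {w : UnitAddTorus d → EuclideanSpace ℝ d} (hw : FunctionSpaces.Torus.IsContDiff 1 w)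
    (x : UnitAddTorus d) (a : EuclideanSpace ℝ d) :
    ⟪FunctionSpaces.Torus.fderiv w x a, w x⟫_ℝ = 2⁻¹ * ⟪a, FunctionSpaces.Torus.gradient (fun y => ‖w y‖ ^ 2) x⟫_ℝ := by
  rw [← real_inner_comm a (FunctionSpaces.Torus.gradient _ x), FunctionSpaces.Torus.inner_gradient_left, FunctionSpaces.Torus.fderiv_norm_sq_apply hw,
    ← real_inner_comm (w x) (FunctionSpaces.Torus.fderiv w x a)]
  ring

/-- **The inertial term against a truncation, reduced to the tail**: for `v ∈ H`,
`∫ ⟪D(P_m v)(x) v(x), v(x)⟫ dx = ∫ ⟪D(P_m v)(x) v(x), v(x) − P_m v(x)⟫ dx`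
(the part against `P_m v` itself is `½ ∫ ⟪v, ∇|P_m v|²⟫ = 0` by weak incompressibility).
[cite: FMRT2001, Ch. IV (1.8)–(1.9), p. 192] -/
theorem inertialPairing_fourierTruncate_eq {v : L2T d} (hv : v ∈ FunctionSpaces.Torus.energySpace d) (m : ℕ) :
    inertialPairing v (FunctionSpaces.Torus.fourierTruncate m (v : UnitAddTorus d → EuclideanSpace ℝ d)) =
      ∫ x, ⟪FunctionSpaces.Torus.fderiv (FunctionSpaces.Torus.fourierTruncate m (v : UnitAddTorus d → EuclideanSpace ℝ d)) x
          ((v : UnitAddTorus d → EuclideanSpace ℝ d) x),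
        (v : UnitAddTorus d → EuclideanSpace ℝ d) x -
          FunctionSpaces.Torus.fourierTruncate m (v : UnitAddTorus d → EuclideanSpace ℝ d) x⟫_ℝ := by
  rw [inertialPairing]
  set u : UnitAddTorus d → EuclideanSpace ℝ d := (v : UnitAddTorus d → EuclideanSpace ℝ d) with hu
  set w := FunctionSpaces.Torus.fourierTruncate m u with hw_def
  have hmem : MemLp u 2 volume := Lp.memLp v
  have hint : Integrable u volume := hmem.integrable one_le_two
  have hw : FunctionSpaces.Torus.IsSmooth w := FunctionSpaces.Torus.isSmooth_fourierTruncate m u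
  have hw1 : FunctionSpaces.Torus.IsContDiff 1 w := hw.isContDiff (by simp)
  -- measurability of `x ↦ Dw(x)(u x)`
  have haesm : AEStronglyMeasurable (fun x => FunctionSpaces.Torus.fderiv w x (u x)) volume := by
    have h : (fun x => FunctionSpaces.Torus.fderiv w x (u x)) = fun x => ∑ i, (u x) i • FunctionSpaces.Torus.partialDeriv i w x :=
      funext fun x => FunctionSpaces.Torus.fderiv_apply_eq_sum_partialDeriv hw1 x (u x)
    rw [h]
    refine Finset.aestronglyMeasurable_fun_sum _ fun i _ => ?_
    exact ((EuclideanSpace.proj i).continuous.comp_aestronglyMeasurable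
      hmem.aestronglyMeasurable).smul (hw.partialDeriv i).continuous.aestronglyMeasurable
  -- pointwise bounds
  have hDb : ∀ x, ‖FunctionSpaces.Torus.fderiv w x (u x)‖ ≤ ‖u x‖ * truncDerivBound m u :=
    fun x => norm_fderiv_fourierTruncate_apply_le m u x (u x)
  obtain ⟨Cw, hCw⟩ : ∃ C, ∀ x, ‖w x‖ ≤ C :=
    ⟨_, fun x => FunctionSpaces.Torus.norm_realTrigPoly_apply_le _ _ x⟩
  -- integrability of the two pieces
  have hg₁ : Integrable (fun x => ⟪FunctionSpaces.Torus.fderiv w x (u x), w x⟫_ℝ) volume := by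
    refine Integrable.mono' (hint.norm.mul_const (truncDerivBound m u * Cw))
      (haesm.inner hw.continuous.aestronglyMeasurable) (ae_of_all _ fun x => ?_)
    refine (norm_inner_le_norm _ _).trans ?_
    calc ‖FunctionSpaces.Torus.fderiv w x (u x)‖ * ‖w x‖ ≤ (‖u x‖ * truncDerivBound m u) * Cw :=
          mul_le_mul (hDb x) (hCw x) (norm_nonneg _) (mul_nonneg (norm_nonneg _)
            (truncDerivBound_nonneg m u))
      _ = ‖u x‖ * (truncDerivBound m u * Cw) := by ring
  have hg₂ : Integrable (fun x => ⟪FunctionSpaces.Torus.fderiv w x (u x), u x - w x⟫_ℝ) volume := by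
    have hsq : Integrable (fun x => truncDerivBound m u / 2 * (‖u x‖ ^ 2 + ‖u x - w x‖ ^ 2))
        volume :=
      ((hmem.integrable_norm_pow two_ne_zero).add
        ((hmem.sub (FunctionSpaces.Torus.memLp_fourierTruncate m u 2)).integrable_norm_pow two_ne_zero)).const_mul _
    refine Integrable.mono' hsq (haesm.inner (hmem.aestronglyMeasurable.sub
      hw.continuous.aestronglyMeasurable)) (ae_of_all _ fun x => ?_)
    refine (norm_inner_le_norm _ _).trans ?_
    calc ‖FunctionSpaces.Torus.fderiv w x (u x)‖ * ‖u x - w x‖ ≤ (‖u x‖ * truncDerivBound m u) * ‖u x - w x‖ :=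
          mul_le_mul_of_nonneg_right (hDb x) (norm_nonneg _)
      _ = truncDerivBound m u / 2 * (2 * (‖u x‖ * ‖u x - w x‖)) := by ring
      _ ≤ truncDerivBound m u / 2 * (‖u x‖ ^ 2 + ‖u x - w x‖ ^ 2) := by
          refine mul_le_mul_of_nonneg_left (by nlinarith [two_mul_le_add_sq ‖u x‖ ‖u x - w x‖])
            (div_nonneg (truncDerivBound_nonneg m u) zero_le_two)
  -- the piece against `w` vanishes
  have hg₁0 : ∫ x, ⟪FunctionSpaces.Torus.fderiv w x (u x), w x⟫_ℝ = 0 := by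
    simp_rw [inner_fderiv_apply_self_eq hw1, integral_const_mul]
    rw [isWeaklyDivFree_of_mem_energySpace hv _ hw.norm_sq, mul_zero]
  -- split
  have hsplit : ∀ x, ⟪FunctionSpaces.Torus.fderiv w x (u x), u x⟫_ℝ =
      ⟪FunctionSpaces.Torus.fderiv w x (u x), w x⟫_ℝ + ⟪FunctionSpaces.Torus.fderiv w x (u x), u x - w x⟫_ℝ := by
    intro x
    rw [← inner_add_right, add_sub_cancel]
  simp_rw [hsplit]
  rw [integral_add hg₁ hg₂, hg₁0, zero_add]

/-- **The 2D Galerkin inertial estimate** (replacing Ladyzhenskaya by two Bernstein bounds and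
the spectral gap of the tail): for `v ∈ H` with finite enstrophy on `T²`,
`(∫ (v ⊗ v) : ∇P_m v)² ≤ (36/π²) |P_m v|² ‖∇v‖₂² · tail_m(v)`, where
`tail_m(v) = 4π² ∑_{|k|>m} |k|² ‖v̂(k)‖²`. Writing `r = v − P_m v`, the term is
`∫ ⟪D(P_m v) v, r⟫`, bounded by `K_m (|P_m v| |r| + |r|²)` with `K_m² ≤ 4N_m ‖∇v‖²`,
`K_m² ≤ 16π²m²N_m |P_m v|²`, `|r|² ≤ tail_m/(4π²(m²+1))` and `N_m ≤ (2m+1)²`; only the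
`L²` norm of the *truncation* enters (cf. FMRT 2001, Ch. IV App. B.1 (B.10)–(B.11), p. 252: the
trilinear Galerkin-tail estimate in dimension 2).
[cite: FMRT2001, Ch. IV App. B.1 (B.10)–(B.11), p. 252] -/
theorem sq_inertialPairing_fourierTruncate_le_truncNorm (hd : Fintype.card d = 2) {v : L2T d}
    (hv : v ∈ FunctionSpaces.Torus.energySpace d)
    (hfin : FunctionSpaces.Torus.eGradNormSq (v : UnitAddTorus d → EuclideanSpace ℝ d) ≠ ⊤) (m : ℕ) :
    (inertialPairing v (FunctionSpaces.Torus.fourierTruncate m (v : UnitAddTorus d → EuclideanSpace ℝ d))) ^ 2 ≤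
      36 / Real.pi ^ 2 *
        (∫ x, ‖FunctionSpaces.Torus.fourierTruncate m (v : UnitAddTorus d → EuclideanSpace ℝ d) x‖ ^ 2) *
        (FunctionSpaces.Torus.eGradNormSq (v : UnitAddTorus d → EuclideanSpace ℝ d)).toReal *
        (tailGradNormSq m (v : UnitAddTorus d → EuclideanSpace ℝ d)).toReal := by
  rw [inertialPairing_fourierTruncate_eq hv m]
  set u : UnitAddTorus d → EuclideanSpace ℝ d := (v : UnitAddTorus d → EuclideanSpace ℝ d) with hu
  set w := FunctionSpaces.Torus.fourierTruncate m u with hw_def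
  set K := truncDerivBound m u with hK_def
  set G := (FunctionSpaces.Torus.eGradNormSq u).toReal with hG_def
  set T := (tailGradNormSq m u).toReal with hT_def
  set P := ∫ x, ‖w x‖ ^ 2 with hP_def
  have hmem : MemLp u 2 volume := Lp.memLp v
  have hint : Integrable u volume := hmem.integrable one_le_two
  have hwmem : MemLp w 2 volume := FunctionSpaces.Torus.memLp_fourierTruncate m u 2
  have hsubmem : MemLp (fun x => u x - w x) 2 volume := hmem.sub hwmem
  have hK0 : 0 ≤ K := truncDerivBound_nonneg m u
  have hG0 : 0 ≤ G := ENNReal.toReal_nonneg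
  have hT0 : 0 ≤ T := ENNReal.toReal_nonneg
  have hP0 : 0 ≤ P := integral_nonneg fun x => sq_nonneg _
  have htail : tailGradNormSq m u ≠ ⊤ := ne_top_of_le_ne_top hfin (tailGradNormSq_le m u)
  -- Step 1: `|∫ g₂| ≤ K (∫ ‖w‖ ‖u - w‖ + ∫ ‖u - w‖²)`
  have hprod : Integrable (fun x => ‖w x‖ * ‖u x - w x‖) volume := by
    refine Integrable.mono' (((hwmem.integrable_norm_pow two_ne_zero).add
      (hsubmem.integrable_norm_pow two_ne_zero)).div_const 2)
      (hwmem.aestronglyMeasurable.norm.mul hsubmem.aestronglyMeasurable.norm)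
      (ae_of_all _ fun x => ?_)
    rw [Real.norm_of_nonneg (mul_nonneg (norm_nonneg _) (norm_nonneg _))]
    have := two_mul_le_add_sq ‖w x‖ ‖u x - w x‖
    simp only [Pi.add_apply]
    linarith
  have hsq : Integrable (fun x => ‖u x - w x‖ ^ 2) volume :=
    hsubmem.integrable_norm_pow two_ne_zero
  have h1 : |∫ x, ⟪FunctionSpaces.Torus.fderiv w x (u x), u x - w x⟫_ℝ| ≤
      K * ((∫ x, ‖w x‖ * ‖u x - w x‖) + ∫ x, ‖u x - w x‖ ^ 2) := by
    rw [← integral_add hprod hsq, ← Real.norm_eq_abs, ← integral_const_mul]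
    refine norm_integral_le_of_norm_le ((hprod.add hsq).const_mul K) (ae_of_all _ fun x => ?_)
    refine (norm_inner_le_norm _ _).trans ?_
    have hux : ‖u x‖ ≤ ‖w x‖ + ‖u x - w x‖ := by
      calc ‖u x‖ = ‖w x + (u x - w x)‖ := by rw [add_sub_cancel]
        _ ≤ ‖w x‖ + ‖u x - w x‖ := norm_add_le _ _
    calc ‖FunctionSpaces.Torus.fderiv w x (u x)‖ * ‖u x - w x‖ ≤ (‖u x‖ * K) * ‖u x - w x‖ :=
          mul_le_mul_of_nonneg_right (norm_fderiv_fourierTruncate_apply_le m u x (u x))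
            (norm_nonneg _)
      _ ≤ ((‖w x‖ + ‖u x - w x‖) * K) * ‖u x - w x‖ := by gcongr
      _ = K * (‖w x‖ * ‖u x - w x‖ + ‖u x - w x‖ ^ 2) := by ring
  -- Step 2: Cauchy–Schwarz `∫ ‖w‖‖u - w‖ ≤ √P ρ`, `ρ² = ∫ ‖u - w‖²`
  set ρ : ℝ := Real.sqrt (∫ x, ‖u x - w x‖ ^ 2) with hρ
  have hρ0 : 0 ≤ ρ := Real.sqrt_nonneg _
  have hρsq : ∫ x, ‖u x - w x‖ ^ 2 = ρ ^ 2 := by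
    rw [hρ, Real.sq_sqrt (integral_nonneg fun x => sq_nonneg _)]
  have h2 : ∫ x, ‖w x‖ * ‖u x - w x‖ ≤ Real.sqrt P * ρ := by
    have h := integral_mul_norm_le_Lp_mul_Lq (μ := volume) Real.HolderConjugate.two_two
      (f := w) (g := fun x => u x - w x) (by simpa using hwmem) (by simpa using hsubmem)
    refine h.trans (le_of_eq ?_)
    rw [← Real.sqrt_eq_rpow, ← Real.sqrt_eq_rpow, hρ]
    congr 1
    · simp only [Real.rpow_two]
      rfl
    · simp only [Real.rpow_two]
  -- Step 3: the spectral inputs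
  have hρ2 : ρ ^ 2 ≤ T / (4 * Real.pi ^ 2 * ((m : ℝ) ^ 2 + 1)) := by
    rw [hρ, Real.sq_sqrt (integral_nonneg fun x => sq_nonneg _)]
    have h := integral_norm_sq_fourierTruncate_sub_le hmem m htail
    refine le_trans (le_of_eq (integral_congr_ae (ae_of_all _ fun x => ?_))) h
    dsimp only
    rw [norm_sub_rev]
  have hK2 : K ^ 2 ≤ 4 * (FunctionSpaces.Torus.freqBall (d := d) m).card * G := by
    have hGw : (FunctionSpaces.Torus.eGradNormSq (FunctionSpaces.Torus.fourierTruncate m u)).toReal ≤ G :=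
      ENNReal.toReal_mono hfin (eGradNormSq_fourierTruncate_le hint m)
    exact (truncDerivBound_sq_le hd hint m).trans
      (mul_le_mul_of_nonneg_left hGw (mul_nonneg (by norm_num) (Nat.cast_nonneg _)))
  have hK2' : K ^ 2 ≤ 16 * Real.pi ^ 2 * (m : ℝ) ^ 2 * (FunctionSpaces.Torus.freqBall (d := d) m).card * P :=
    truncDerivBound_sq_le_integral hd hint m
  have hcard : ((FunctionSpaces.Torus.freqBall (d := d) m).card : ℝ) ≤ (2 * m + 1) ^ 2 := by
    have h := card_freqBall_le (d := d) m
    rw [hd] at h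
    exact_mod_cast h
  set N : ℝ := ((FunctionSpaces.Torus.freqBall (d := d) m).card : ℝ) with hN_def
  set M : ℝ := (m : ℝ) ^ 2 + 1 with hM_def
  have hM : 0 < M := by positivity
  have hm0 : (0 : ℝ) ≤ m := Nat.cast_nonneg m
  have hNM : N ≤ 9 * M := by
    rw [hM_def]
    nlinarith [hcard, sq_nonneg ((m : ℝ) - 1), hm0]
  have hmNM : (m : ℝ) ^ 2 * N ≤ 9 * M ^ 2 := by
    have h3 : (m : ℝ) * (2 * m + 1) ≤ 3 * M := by
      rw [hM_def]
      nlinarith [sq_nonneg ((m : ℝ) - 1), hm0]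
    have hN0 : 0 ≤ N := by rw [hN_def]; exact Nat.cast_nonneg _
    calc (m : ℝ) ^ 2 * N ≤ (m : ℝ) ^ 2 * (2 * m + 1) ^ 2 :=
          mul_le_mul_of_nonneg_left hcard (by positivity)
      _ = ((m : ℝ) * (2 * m + 1)) ^ 2 := by ring
      _ ≤ (3 * M) ^ 2 := pow_le_pow_left₀ (by positivity) h3 2
      _ = 9 * M ^ 2 := by ring
  have hTG : T ≤ G := ENNReal.toReal_mono hfin (tailGradNormSq_le m u)
  -- Step 4: combine
  have h3 : |∫ x, ⟪FunctionSpaces.Torus.fderiv w x (u x), u x - w x⟫_ℝ| ≤ K * (Real.sqrt P * ρ + ρ ^ 2) := by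
    refine h1.trans (mul_le_mul_of_nonneg_left ?_ hK0)
    rw [← hρsq]
    exact add_le_add h2 le_rfl
  have hsP : Real.sqrt P ^ 2 = P := Real.sq_sqrt hP0
  have h4 : (∫ x, ⟪FunctionSpaces.Torus.fderiv w x (u x), u x - w x⟫_ℝ) ^ 2 ≤
      2 * (K ^ 2 * P * ρ ^ 2) + 2 * (K ^ 2 * (ρ ^ 2) ^ 2) := by
    have h5 := pow_le_pow_left₀ (abs_nonneg _) h3 2
    rw [sq_abs] at h5
    have hxy : (Real.sqrt P * ρ + ρ ^ 2) ^ 2 ≤ 2 * (Real.sqrt P * ρ) ^ 2 + 2 * (ρ ^ 2) ^ 2 := by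
      nlinarith [sq_nonneg (Real.sqrt P * ρ - ρ ^ 2)]
    calc (∫ x, ⟪FunctionSpaces.Torus.fderiv w x (u x), u x - w x⟫_ℝ) ^ 2
        ≤ (K * (Real.sqrt P * ρ + ρ ^ 2)) ^ 2 := h5
      _ = K ^ 2 * (Real.sqrt P * ρ + ρ ^ 2) ^ 2 := by ring
      _ ≤ K ^ 2 * (2 * (Real.sqrt P * ρ) ^ 2 + 2 * (ρ ^ 2) ^ 2) :=
          mul_le_mul_of_nonneg_left hxy (sq_nonneg K)
      _ = 2 * (K ^ 2 * P * ρ ^ 2) + 2 * (K ^ 2 * (ρ ^ 2) ^ 2) := by rw [mul_pow, hsP]; ring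
  have hρ2' : ρ ^ 2 * (4 * Real.pi ^ 2 * M) ≤ T := (le_div_iff₀ (by positivity)).1 hρ2
  have hπ : 0 < Real.pi ^ 2 := by positivity
  have hN0 : 0 ≤ N := by rw [hN_def]; exact Nat.cast_nonneg _
  have hX0 : 0 ≤ ρ ^ 2 * (4 * Real.pi ^ 2 * M) := by positivity
  -- the first term: `K² P ρ² (4π² M) ≤ 4 N G P T ≤ 36 M G P T`
  have hA : K ^ 2 * P * ρ ^ 2 * Real.pi ^ 2 ≤ 9 * P * G * T := by
    have h8 : (K ^ 2 * P * ρ ^ 2 * Real.pi ^ 2) * (4 * M) ≤ (9 * P * G * T) * (4 * M) := by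
      calc (K ^ 2 * P * ρ ^ 2 * Real.pi ^ 2) * (4 * M)
          = K ^ 2 * P * (ρ ^ 2 * (4 * Real.pi ^ 2 * M)) := by ring
        _ ≤ (4 * N * G) * P * T :=
            mul_le_mul (mul_le_mul_of_nonneg_right hK2 hP0) hρ2' hX0
              (mul_nonneg (mul_nonneg (mul_nonneg (by norm_num) hN0) hG0) hP0)
        _ ≤ (4 * (9 * M) * G) * P * T :=
            mul_le_mul_of_nonneg_right (mul_le_mul_of_nonneg_right (mul_le_mul_of_nonneg_right
              (mul_le_mul_of_nonneg_left hNM (by norm_num)) hG0) hP0) hT0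
        _ = (9 * P * G * T) * (4 * M) := by ring
    exact le_of_mul_le_mul_right h8 (by positivity)
  -- the second term: `K² ρ⁴ (4π² M)² ≤ 16 π² m² N P T² ≤ 144 π² M² P G T`
  have hB : K ^ 2 * (ρ ^ 2) ^ 2 * Real.pi ^ 2 ≤ 9 * P * G * T := by
    have hT2 : T ^ 2 ≤ G * T := by rw [sq]; exact mul_le_mul_of_nonneg_right hTG hT0
    have h8 : (K ^ 2 * (ρ ^ 2) ^ 2 * Real.pi ^ 2) * (16 * Real.pi ^ 2 * M ^ 2) ≤
        (9 * P * G * T) * (16 * Real.pi ^ 2 * M ^ 2) := by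
      calc (K ^ 2 * (ρ ^ 2) ^ 2 * Real.pi ^ 2) * (16 * Real.pi ^ 2 * M ^ 2)
          = K ^ 2 * (ρ ^ 2 * (4 * Real.pi ^ 2 * M)) ^ 2 := by ring
        _ ≤ (16 * Real.pi ^ 2 * (m : ℝ) ^ 2 * N * P) * T ^ 2 :=
            mul_le_mul hK2' (pow_le_pow_left₀ hX0 hρ2' 2) (sq_nonneg _)
              (mul_nonneg (mul_nonneg (by positivity) hN0) hP0)
        _ = (16 * Real.pi ^ 2 * ((m : ℝ) ^ 2 * N)) * P * T ^ 2 := by ring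
        _ ≤ (16 * Real.pi ^ 2 * (9 * M ^ 2)) * P * (G * T) :=
            mul_le_mul (mul_le_mul_of_nonneg_right (mul_le_mul_of_nonneg_left hmNM
              (by positivity)) hP0) hT2 (by positivity) (by positivity)
        _ = (9 * P * G * T) * (16 * Real.pi ^ 2 * M ^ 2) := by ring
    exact le_of_mul_le_mul_right h8 (by positivity)
  have hfinal : (2 * (K ^ 2 * P * ρ ^ 2) + 2 * (K ^ 2 * (ρ ^ 2) ^ 2)) * Real.pi ^ 2 ≤
      36 * P * G * T := by
    calc (2 * (K ^ 2 * P * ρ ^ 2) + 2 * (K ^ 2 * (ρ ^ 2) ^ 2)) * Real.pi ^ 2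
        = 2 * (K ^ 2 * P * ρ ^ 2 * Real.pi ^ 2) + 2 * (K ^ 2 * (ρ ^ 2) ^ 2 * Real.pi ^ 2) := by ring
      _ ≤ 2 * (9 * P * G * T) + 2 * (9 * P * G * T) :=
          add_le_add (mul_le_mul_of_nonneg_left hA zero_le_two)
            (mul_le_mul_of_nonneg_left hB zero_le_two)
      _ = 36 * P * G * T := by ring
  calc (∫ x, ⟪FunctionSpaces.Torus.fderiv w x (u x), u x - w x⟫_ℝ) ^ 2 ≤
        2 * (K ^ 2 * P * ρ ^ 2) + 2 * (K ^ 2 * (ρ ^ 2) ^ 2) := h4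
    _ ≤ 36 / Real.pi ^ 2 * P * G * T := by
        rw [show 36 / Real.pi ^ 2 * P * G * T = (36 * P * G * T) / Real.pi ^ 2 by ring,
          le_div_iff₀ hπ]
        exact hfinal

/-- The same with `|P_m v| ≤ |v|`:
`(∫ (v ⊗ v) : ∇P_m v)² ≤ (36/π²) |v|² ‖∇v‖₂² · tail_m(v)`. [folklore] -/
theorem sq_inertialPairing_fourierTruncate_le (hd : Fintype.card d = 2) {v : L2T d}
    (hv : v ∈ FunctionSpaces.Torus.energySpace d)
    (hfin : FunctionSpaces.Torus.eGradNormSq (v : UnitAddTorus d → EuclideanSpace ℝ d) ≠ ⊤) (m : ℕ) :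
    (inertialPairing v (FunctionSpaces.Torus.fourierTruncate m (v : UnitAddTorus d → EuclideanSpace ℝ d))) ^ 2 ≤
      36 / Real.pi ^ 2 * ‖v‖ ^ 2 * (FunctionSpaces.Torus.eGradNormSq (v : UnitAddTorus d → EuclideanSpace ℝ d)).toReal *
        (tailGradNormSq m (v : UnitAddTorus d → EuclideanSpace ℝ d)).toReal := by
  refine (sq_inertialPairing_fourierTruncate_le_truncNorm hd hv hfin m).trans ?_
  have hP : ∫ x, ‖FunctionSpaces.Torus.fourierTruncate m (v : UnitAddTorus d → EuclideanSpace ℝ d) x‖ ^ 2 ≤ ‖v‖ ^ 2 := by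
    rw [← integral_norm_sq_coe_eq]
    exact FunctionSpaces.Torus.integral_norm_sq_fourierTruncate_le (Lp.memLp v) m
  have hG0 : 0 ≤ (FunctionSpaces.Torus.eGradNormSq (v : UnitAddTorus d → EuclideanSpace ℝ d)).toReal :=
    ENNReal.toReal_nonneg
  have hT0 : 0 ≤ (tailGradNormSq m (v : UnitAddTorus d → EuclideanSpace ℝ d)).toReal :=
    ENNReal.toReal_nonneg
  gcongr

/-- **Domination**: `|∫ (v ⊗ v) : ∇P_m v| ≤ (6/π) |P_m v| ‖∇v‖₂²` on `T²`.
[cite: FMRT2001, Ch. IV App. B.1 (B.11), p. 252] -/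
theorem abs_inertialPairing_fourierTruncate_le (hd : Fintype.card d = 2) {v : L2T d}
    (hv : v ∈ FunctionSpaces.Torus.energySpace d)
    (hfin : FunctionSpaces.Torus.eGradNormSq (v : UnitAddTorus d → EuclideanSpace ℝ d) ≠ ⊤) (m : ℕ) :
    |inertialPairing v (FunctionSpaces.Torus.fourierTruncate m (v : UnitAddTorus d → EuclideanSpace ℝ d))| ≤
      6 / Real.pi *
        Real.sqrt (∫ x, ‖FunctionSpaces.Torus.fourierTruncate m (v : UnitAddTorus d → EuclideanSpace ℝ d) x‖ ^ 2) *
        (FunctionSpaces.Torus.eGradNormSq (v : UnitAddTorus d → EuclideanSpace ℝ d)).toReal := by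
  have h := sq_inertialPairing_fourierTruncate_le_truncNorm hd hv hfin m
  set P := ∫ x, ‖FunctionSpaces.Torus.fourierTruncate m (v : UnitAddTorus d → EuclideanSpace ℝ d) x‖ ^ 2 with hP
  set G := (FunctionSpaces.Torus.eGradNormSq (v : UnitAddTorus d → EuclideanSpace ℝ d)).toReal with hG
  set T := (tailGradNormSq m (v : UnitAddTorus d → EuclideanSpace ℝ d)).toReal with hT
  have hP0 : 0 ≤ P := integral_nonneg fun x => sq_nonneg _
  have hG0 : 0 ≤ G := ENNReal.toReal_nonneg
  have hTG : T ≤ G := ENNReal.toReal_mono hfin (tailGradNormSq_le m _)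
  have hC0 : 0 ≤ 6 / Real.pi * Real.sqrt P * G := by positivity
  have h2 : (inertialPairing v (FunctionSpaces.Torus.fourierTruncate m (v : UnitAddTorus d → EuclideanSpace ℝ d))) ^ 2 ≤
      (6 / Real.pi * Real.sqrt P * G) ^ 2 := by
    refine h.trans ?_
    have hπ : 0 < Real.pi := Real.pi_pos
    have hsP : Real.sqrt P ^ 2 = P := Real.sq_sqrt hP0
    calc 36 / Real.pi ^ 2 * P * G * T ≤ 36 / Real.pi ^ 2 * P * G * G := by gcongr
      _ = (6 / Real.pi * Real.sqrt P * G) ^ 2 := by rw [mul_pow, mul_pow, hsP]; field_simp; ring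
  exact abs_le.2 ⟨(abs_le_of_sq_le_sq' h2 hC0).1, (abs_le_of_sq_le_sq' h2 hC0).2⟩

/-- **Convergence**: `∫ (v ⊗ v) : ∇P_m v → 0` as `m → ∞` for `v ∈ V` on `T²`
(`b(v, v, P_m v) → b(v, v, v) = 0`; FMRT 2001, Ch. IV (1.8) and App. B.1).
[cite: FMRT2001, Ch. IV (1.8), p. 192 and App. B.1, p. 249] -/
theorem tendsto_inertialPairing_fourierTruncate (hd : Fintype.card d = 2) {v : L2T d}
    (hv : v ∈ FunctionSpaces.Torus.energySpace d)
    (hfin : FunctionSpaces.Torus.eGradNormSq (v : UnitAddTorus d → EuclideanSpace ℝ d) ≠ ⊤) :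
    Tendsto
      (fun m => inertialPairing v (FunctionSpaces.Torus.fourierTruncate m (v : UnitAddTorus d → EuclideanSpace ℝ d)))
      atTop (𝓝 0) := by
  set C : ℝ :=
    36 / Real.pi ^ 2 * ‖v‖ ^ 2 * (FunctionSpaces.Torus.eGradNormSq (v : UnitAddTorus d → EuclideanSpace ℝ d)).toReal
    with hC
  have hC0 : 0 ≤ C := by positivity
  have hT : Tendsto (fun m => (tailGradNormSq m (v : UnitAddTorus d → EuclideanSpace ℝ d)).toReal)
      atTop (𝓝 0) := by
    have h := tendsto_tailGradNormSq hfin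
    rw [← ENNReal.toReal_zero]
    exact (ENNReal.tendsto_toReal ENNReal.zero_ne_top).comp h
  have hbound : ∀ m,
      |inertialPairing v (FunctionSpaces.Torus.fourierTruncate m (v : UnitAddTorus d → EuclideanSpace ℝ d))| ≤
      Real.sqrt (C * (tailGradNormSq m (v : UnitAddTorus d → EuclideanSpace ℝ d)).toReal) := by
    intro m
    rw [← Real.sqrt_sq_eq_abs]
    exact Real.sqrt_le_sqrt (by rw [hC]; exact sq_inertialPairing_fourierTruncate_le hd hv hfin m)
  have hlim : Tendsto (fun m => Real.sqrt (C * (tailGradNormSq m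
      (v : UnitAddTorus d → EuclideanSpace ℝ d)).toReal)) atTop (𝓝 0) := by
    have := (hT.const_mul C).sqrt
    rw [mul_zero, Real.sqrt_zero] at this
    exact this
  exact squeeze_zero_norm (fun m => by rw [Real.norm_eq_abs]; exact hbound m) hlim

end Inertial


/-! ### Convergence of the Galerkin-tested generator -/

section Convergence

/-- **The forcing term converges**: `(f, P_m v) → (f, v)` for `f, v ∈ L²`. [folklore] -/
theorem tendsto_integral_inner_fourierTruncate {f v : UnitAddTorus d → EuclideanSpace ℝ d}
    (hf : MemLp f 2 volume) (hv : MemLp v 2 volume) :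
    Tendsto (fun m => ∫ x, ⟪f x, FunctionSpaces.Torus.fourierTruncate m v x⟫_ℝ) atTop (𝓝 (∫ x, ⟪f x, v x⟫_ℝ)) := by
  have h := (FunctionSpaces.Torus.hasSum_re_inner_mFourierCoeff_complexify hf hv).comp FunctionSpaces.Torus.tendsto_freqBall_atTop
  refine h.congr fun m => ?_
  rw [Function.comp_apply, FunctionSpaces.Torus.fourierTruncate_eq,
    FunctionSpaces.Torus.integral_inner_realTrigPoly_of_integrable _ _ (hf.integrable one_le_two)]

/-- The enstrophy of a truncation as a finite spectral sum in `ℝ≥0∞`. [folklore] -/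
theorem eGradNormSq_fourierTruncate_eq_sum {v : UnitAddTorus d → EuclideanSpace ℝ d}
    (hv : Integrable v volume) (m : ℕ) :
    FunctionSpaces.Torus.eGradNormSq (FunctionSpaces.Torus.fourierTruncate m v) = ENNReal.ofReal (4 * Real.pi ^ 2) *
      ∑ k ∈ FunctionSpaces.Torus.freqBall m, ENNReal.ofReal (FunctionSpaces.Torus.freqNormSq k) *
        ‖mFourierCoeff (FunctionSpaces.EuclideanSpace.complexify ∘ v) k‖ₑ ^ 2 := by
  rw [FunctionSpaces.Torus.eGradNormSq_eq_tsum]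
  congr 1
  rw [tsum_eq_sum (s := FunctionSpaces.Torus.freqBall m) fun k hk => by
    rw [FunctionSpaces.Torus.mFourierCoeff_fourierTruncate hv, if_neg hk]; simp]
  refine Finset.sum_congr rfl fun k hk => ?_
  rw [FunctionSpaces.Torus.mFourierCoeff_fourierTruncate hv, if_pos hk]

/-- **The enstrophy of the truncations converges**: `‖∇P_m v‖₂² → ‖∇v‖₂²` for finite-enstrophy `v`.
[folklore] -/
theorem tendsto_toReal_eGradNormSq_fourierTruncate {v : UnitAddTorus d → EuclideanSpace ℝ d}
    (hv : Integrable v volume) (hfin : FunctionSpaces.Torus.eGradNormSq v ≠ ⊤) :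
    Tendsto (fun m => (FunctionSpaces.Torus.eGradNormSq (FunctionSpaces.Torus.fourierTruncate m v)).toReal) atTop
      (𝓝 (FunctionSpaces.Torus.eGradNormSq v).toReal) := by
  have hsum : HasSum (fun k : d → ℤ => ENNReal.ofReal (FunctionSpaces.Torus.freqNormSq k) *
      ‖mFourierCoeff (FunctionSpaces.EuclideanSpace.complexify ∘ v) k‖ₑ ^ 2)
      (∑' k : d → ℤ, ENNReal.ofReal (FunctionSpaces.Torus.freqNormSq k) *
        ‖mFourierCoeff (FunctionSpaces.EuclideanSpace.complexify ∘ v) k‖ₑ ^ 2) := ENNReal.summable.hasSum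
  have h1 := (ENNReal.Tendsto.const_mul (a := ENNReal.ofReal (4 * Real.pi ^ 2))
    (hsum.comp FunctionSpaces.Torus.tendsto_freqBall_atTop) (Or.inr ENNReal.ofReal_ne_top))
  rw [← FunctionSpaces.Torus.eGradNormSq_eq_tsum] at h1
  have h2 := (ENNReal.tendsto_toReal hfin).comp h1
  refine h2.congr fun m => ?_
  simp only [Function.comp_apply]
  rw [← eGradNormSq_fourierTruncate_eq_sum hv]

omit [DecidableEq d] in
/-- Elementary bound for the forcing term: `|(f, w)| ≤ ½ (∫ ‖f‖² + ∫ ‖w‖²)`. [folklore] -/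
theorem abs_integral_inner_le {f w : UnitAddTorus d → EuclideanSpace ℝ d} (hf : MemLp f 2 volume)
    (hw : MemLp w 2 volume) :
    |∫ x, ⟪f x, w x⟫_ℝ| ≤ 2⁻¹ * ((∫ x, ‖f x‖ ^ 2) + ∫ x, ‖w x‖ ^ 2) := by
  rw [← integral_add (hf.integrable_norm_pow two_ne_zero) (hw.integrable_norm_pow two_ne_zero),
    ← integral_const_mul, ← Real.norm_eq_abs]
  refine norm_integral_le_of_norm_le (((hf.integrable_norm_pow two_ne_zero).add
    (hw.integrable_norm_pow two_ne_zero)).const_mul _) (ae_of_all _ fun x => ?_)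
  refine (norm_inner_le_norm _ _).trans ?_
  dsimp only
  nlinarith [two_mul_le_add_sq ‖f x‖ ‖w x‖]

end Convergence

/-! ### The energy equation in dimension two -/

section EnergyEquation

/-- The squared `L²` norm `|P_m u|² = ∫ ‖P_m u‖²` of the truncation of `u ∈ H`. [folklore] -/
def truncNormSq (m : ℕ) (u : FunctionSpaces.Torus.energySpace d) : ℝ :=
  ∫ y, ‖FunctionSpaces.Torus.fourierTruncate m (((u : L2T d)) : UnitAddTorus d → EuclideanSpace ℝ d) y‖ ^ 2

/-- `0 ≤ |P_m u|²`. [folklore] -/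
theorem truncNormSq_nonneg (m : ℕ) (u : FunctionSpaces.Torus.energySpace d) : 0 ≤ truncNormSq m u :=
  integral_nonneg fun _ => sq_nonneg _

/-- Bessel: `|P_m u|² ≤ |u|²`. [folklore] -/
theorem truncNormSq_le (m : ℕ) (u : FunctionSpaces.Torus.energySpace d) : truncNormSq m u ≤ ‖u‖ ^ 2 := by
  rw [truncNormSq, Submodule.coe_norm, ← integral_norm_sq_coe_eq]
  exact FunctionSpaces.Torus.integral_norm_sq_fourierTruncate_le (Lp.memLp _) m

/-- Parseval: `|P_m u|² → |u|²` as `m → ∞`. [folklore] -/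
theorem tendsto_truncNormSq (u : FunctionSpaces.Torus.energySpace d) :
    Tendsto (fun m => truncNormSq m u) atTop (𝓝 (‖u‖ ^ 2)) := by
  have hmem : MemLp (((u : L2T d)) : UnitAddTorus d → EuclideanSpace ℝ d) 2 volume := Lp.memLp _
  have h := (FunctionSpaces.Torus.hasSum_sq_norm_mFourierCoeff_complexify hmem).comp FunctionSpaces.Torus.tendsto_freqBall_atTop
  rw [Submodule.coe_norm, ← integral_norm_sq_coe_eq]
  refine h.congr fun m => ?_
  rw [Function.comp_apply, truncNormSq,
    FunctionSpaces.Torus.integral_norm_sq_fourierTruncate (hmem.integrable one_le_two)]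

/-- The **Galerkin energy balance** of `u ∈ H` at order `m`:
`(f, P_m u) − ν ‖∇P_m u‖² + ∫ (u ⊗ u) : ∇P_m u` — one half of the generator `⟨F(u), ·⟩` tested
against `2 P_m u` (FMRT 2001, Ch. IV (1.11)). [cite: FMRT2001, Ch. IV (1.11), p. 193] -/
def galerkinBalance (ν : ℝ) (f : UnitAddTorus d → EuclideanSpace ℝ d) (m : ℕ) (u : FunctionSpaces.Torus.energySpace d) :
    ℝ :=
  (∫ x, ⟪f x, FunctionSpaces.Torus.fourierTruncate m (((u : L2T d)) : UnitAddTorus d → EuclideanSpace ℝ d) x⟫_ℝ) -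
    ν * (FunctionSpaces.Torus.eGradNormSq (FunctionSpaces.Torus.fourierTruncate m
      (((u : L2T d)) : UnitAddTorus d → EuclideanSpace ℝ d))).toReal +
    inertialPairing (u : L2T d)
      (FunctionSpaces.Torus.fourierTruncate m (((u : L2T d)) : UnitAddTorus d → EuclideanSpace ℝ d))

variable {ν : ℝ} {f : UnitAddTorus d → EuclideanSpace ℝ d} {μ : Measure (FunctionSpaces.Torus.energySpace d)}

/-- **The weighted Galerkin energy balances vanish in the mean**: for a stationary statistical
solution, every order `m` and every level `a > 0`,
`∫ w(|P_m u|²/a) [(f, P_m u) − ν ‖∇P_m u‖² + ∫ (u ⊗ u) : ∇P_m u] dμ(u) = 0` with an integrable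
integrand — the Liouville equation (1.30) for the cylindrical functional `galerkinTest m ha`
(`Φ(u) = ρ_a(|P_m u|²)`, `Φ'(u) = 2 w(|P_m u|²/a) P_m u`). No sign condition on `ν` is used.
[cite: FMRT2001, Ch. IV (1.30), p. 197] -/
theorem IsStationaryStatisticalSolution.integral_galerkinBalance_eq_zero
    (hμ : IsStationaryStatisticalSolution ν f μ) (m : ℕ) {a : ℝ} (ha : 0 < a) :
    Integrable (fun u : FunctionSpaces.Torus.energySpace d =>
      galerkinWeight (truncNormSq m u / a) * galerkinBalance ν f m u) μ ∧
    ∫ u, galerkinWeight (truncNormSq m u / a) * galerkinBalance ν f m u ∂μ = 0 := by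
  obtain ⟨hint, hzero⟩ := hμ.generator (galerkinTest m ha)
  have hpt : ∀ u : FunctionSpaces.Torus.energySpace d, nsGeneratorPairing ν f u ((galerkinTest m ha).grad u) =
      2 * (galerkinWeight (truncNormSq m u / a) * galerkinBalance ν f m u) := by
    intro u
    rw [grad_galerkinTest ha u, nsGeneratorPairing_smul_fourierTruncate, truncNormSq,
      galerkinBalance]
    ring
  simp_rw [hpt] at hint hzero
  refine ⟨?_, ?_⟩
  · refine (hint.const_mul (2⁻¹ : ℝ)).congr (ae_of_all _ fun u => ?_)
    dsimp only
    ring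
  · rw [integral_const_mul] at hzero
    linarith

/-- **The mean energy equation in dimension two holds — for every real `ν`.** Proof of the vendored
fact `IsStationaryStatisticalSolution.energy_eq` (FMRT 2001, Ch. IV: under the standing
hypothesis `ν > 0` of (1.1), p. 190, a stationary statistical solution in dimension `2` is an
invariant measure, Thm. 2.2, p. 205, and satisfies the energy equation, App. B.1, p. 248).

The argument given here is the direct Galerkin one and uses only (1.29)–(1.30) (finite mean
enstrophy and the Liouville equation), so that neither the energy inequality (1.31) nor the sign
of `ν` enters: by `integral_galerkinBalance_eq_zero`,
`∫ w(|P_m u|²/a) [(f, P_m u) − ν‖∇P_m u‖² + ∫ (u ⊗ u):∇P_m u] dμ = 0`; as `m → ∞` the integrand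
tends `μ`-a.e. (`u ∈ V`) to `w(|u|²/a) [(f, u) − ν‖∇u‖²]` (`tendsto_truncNormSq`,
`tendsto_integral_inner_fourierTruncate`, `tendsto_toReal_eGradNormSq_fourierTruncate`,
`tendsto_inertialPairing_fourierTruncate`), dominated thanks to the weight: on its support
`|P_m u|² ≤ 2a`, so `|∫ (u ⊗ u):∇P_m u| ≤ (6/π)√(2a) ‖∇u‖²` by
`abs_inertialPairing_fourierTruncate_le`; hence `∫ w(|u|²/a) [(f, u) − ν‖∇u‖²] dμ = 0` for
every `a > 0`, and `a → ∞` (`w(|u|²/a) → w(0) = 1`, `|w| ≤ C_w`) gives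
`∫ (f, u) dμ = ν ∫ ‖∇u‖² dμ`. [cite: FMRT2001, Ch. IV Thm. 2.2 (p. 205) with App. B.1 (p. 248)] -/
theorem IsStationaryStatisticalSolution.energy_eq_holds :
    IsStationaryStatisticalSolution.energy_eq (d := d) := by
  intro ν f μ hd hμ hf
  haveI := hμ.prob
  obtain ⟨Cw, hCw1, hCw⟩ := exists_abs_galerkinWeight_le
  have hCw0 : 0 ≤ Cw := zero_le_one.trans hCw1
  -- abbreviations and integrability
  set G : FunctionSpaces.Torus.energySpace d → ℝ := fun u =>
    (FunctionSpaces.Torus.eGradNormSq (((u : L2T d)) : UnitAddTorus d → EuclideanSpace ℝ d)).toReal with hG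
  set Flim : FunctionSpaces.Torus.energySpace d → ℝ := fun u =>
    (∫ x, ⟪f x, (((u : L2T d)) : UnitAddTorus d → EuclideanSpace ℝ d) x⟫_ℝ) - ν * G u with hFlim
  have hpair : ∀ u : FunctionSpaces.Torus.energySpace d,
      ∫ x, ⟪f x, (((u : L2T d)) : UnitAddTorus d → EuclideanSpace ℝ d) x⟫_ℝ =
        pairing (u : L2T d) f := by
    intro u
    rw [pairing]
    exact integral_congr_ae (ae_of_all _ fun x => real_inner_comm _ _)
  have hI1 : Integrable (fun u : FunctionSpaces.Torus.energySpace d => pairing (u : L2T d) f) μ :=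
    hμ.integrable_pairing hf
  have hI2 : Integrable G μ := hμ.integrable_toReal_eGradNormSq
  have hFlim_int : Integrable Flim μ := by
    have h : Flim = fun u : FunctionSpaces.Torus.energySpace d => pairing (u : L2T d) f - ν * G u := by
      funext u
      rw [hFlim]
      dsimp only
      rw [hpair]
    rw [h]
    exact hI1.sub (hI2.const_mul ν)
  -- Step 1: for every level `a = n + 1`, `∫ w(|u|²/a) Flim dμ = 0` (limit `m → ∞`)
  have hlevel : ∀ n : ℕ, ∫ u, galerkinWeight (‖u‖ ^ 2 / ((n : ℝ) + 1)) * Flim u ∂μ = 0 := by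
    intro n
    have ha : (0 : ℝ) < (n : ℝ) + 1 := by positivity
    set a : ℝ := (n : ℝ) + 1 with ha_def
    set F : ℕ → FunctionSpaces.Torus.energySpace d → ℝ := fun m u =>
      galerkinWeight (truncNormSq m u / a) * galerkinBalance ν f m u with hF
    have hFint : ∀ m, Integrable (F m) μ := fun m => (hμ.integral_galerkinBalance_eq_zero m ha).1
    have hFzero : ∀ m, ∫ u, F m u ∂μ = 0 := fun m =>
      (hμ.integral_galerkinBalance_eq_zero m ha).2
    set bound : FunctionSpaces.Torus.energySpace d → ℝ := fun u =>
      Cw * (2⁻¹ * ((∫ x, ‖f x‖ ^ 2) + ‖u‖ ^ 2) +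
        (|ν| + 6 / Real.pi * Real.sqrt (2 * a)) * G u) with hbound
    have hbound_int : Integrable bound μ :=
      ((((integrable_const _).add hμ.integrable_norm_sq).const_mul _).add
        (hI2.const_mul _)).const_mul _
    -- domination
    have hdom : ∀ m, ∀ᵐ u ∂μ, ‖F m u‖ ≤ bound u := by
      intro m
      filter_upwards [hμ.ae_eGradNormSq_lt_top] with u hufin
      have hmem : MemLp (((u : L2T d)) : UnitAddTorus d → EuclideanSpace ℝ d) 2 volume :=
        Lp.memLp _
      have hint : Integrable (((u : L2T d)) : UnitAddTorus d → EuclideanSpace ℝ d) volume :=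
        hmem.integrable one_le_two
      have hG0 : 0 ≤ G u := ENNReal.toReal_nonneg
      have hbound0 : 0 ≤ bound u := by rw [hbound]; positivity
      by_cases ht : truncNormSq m u / a ≤ 2
      · -- on the support of the weight: `|P_m u|² ≤ 2a`
        have hP2a : truncNormSq m u ≤ 2 * a := by rwa [div_le_iff₀ ha] at ht
        have h1 := abs_integral_inner_le hf (FunctionSpaces.Torus.memLp_fourierTruncate m
          (((u : L2T d)) : UnitAddTorus d → EuclideanSpace ℝ d) 2)
        have h1' := truncNormSq_le m u
        have h2 : (FunctionSpaces.Torus.eGradNormSq (FunctionSpaces.Torus.fourierTruncate m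
            (((u : L2T d)) : UnitAddTorus d → EuclideanSpace ℝ d))).toReal ≤ G u :=
          ENNReal.toReal_mono hufin.ne (eGradNormSq_fourierTruncate_le hint m)
        have hGm0 : 0 ≤ (FunctionSpaces.Torus.eGradNormSq (FunctionSpaces.Torus.fourierTruncate m
            (((u : L2T d)) : UnitAddTorus d → EuclideanSpace ℝ d))).toReal :=
          ENNReal.toReal_nonneg
        have h3 := abs_inertialPairing_fourierTruncate_le hd u.2 hufin.ne m
        have hsqrt : Real.sqrt (truncNormSq m u) ≤ Real.sqrt (2 * a) := Real.sqrt_le_sqrt hP2a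
        have h3' : |inertialPairing (u : L2T d)
            (FunctionSpaces.Torus.fourierTruncate m (((u : L2T d)) : UnitAddTorus d → EuclideanSpace ℝ d))| ≤
            6 / Real.pi * Real.sqrt (2 * a) * G u := by
          refine h3.trans ?_
          rw [← truncNormSq]
          gcongr
        have hbal : |galerkinBalance ν f m u| ≤
            2⁻¹ * ((∫ x, ‖f x‖ ^ 2) + ‖u‖ ^ 2) + (|ν| + 6 / Real.pi * Real.sqrt (2 * a)) * G u := by
          rw [galerkinBalance]
          refine (abs_add_le _ _).trans ((add_le_add (abs_sub _ _) le_rfl).trans ?_)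
          rw [abs_mul]
          rw [truncNormSq] at h1'
          nlinarith [abs_nonneg ν, mul_le_mul_of_nonneg_left h2 (abs_nonneg ν),
            abs_of_nonneg hGm0]
        rw [Real.norm_eq_abs, hF]
        dsimp only
        rw [abs_mul, hbound]
        exact mul_le_mul (hCw _) hbal (abs_nonneg _) hCw0
      · -- off the support the integrand vanishes
        have hw : galerkinWeight (truncNormSq m u / a) = 0 :=
          galerkinWeight_eq_zero ((not_le.1 ht).le.trans (le_abs_self _))
        rw [hF]
        dsimp only
        rw [hw, zero_mul, norm_zero]
        exact hbound0
    -- pointwise limit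
    have hlim : ∀ᵐ u ∂μ, Tendsto (fun m => F m u) atTop
        (𝓝 (galerkinWeight (‖u‖ ^ 2 / a) * Flim u)) := by
      filter_upwards [hμ.ae_eGradNormSq_lt_top] with u hufin
      have hmem : MemLp (((u : L2T d)) : UnitAddTorus d → EuclideanSpace ℝ d) 2 volume :=
        Lp.memLp _
      have hint : Integrable (((u : L2T d)) : UnitAddTorus d → EuclideanSpace ℝ d) volume :=
        hmem.integrable one_le_two
      have tw : Tendsto (fun m => galerkinWeight (truncNormSq m u / a)) atTop
          (𝓝 (galerkinWeight (‖u‖ ^ 2 / a))) :=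
        (continuous_galerkinWeight.tendsto _).comp ((tendsto_truncNormSq u).div_const a)
      have t1 := tendsto_integral_inner_fourierTruncate hf hmem
      have t2 := (tendsto_toReal_eGradNormSq_fourierTruncate hint hufin.ne).const_mul ν
      have t3 := tendsto_inertialPairing_fourierTruncate hd u.2 hufin.ne
      have tb : Tendsto (fun m => galerkinBalance ν f m u) atTop (𝓝 (Flim u)) := by
        have := (t1.sub t2).add t3
        rw [add_zero] at this
        exact this
      exact tw.mul tb
    have hmeas : ∀ m, AEStronglyMeasurable (F m) μ := fun m => (hFint m).aestronglyMeasurable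
    have hconv := tendsto_integral_of_dominated_convergence bound hmeas hbound_int hdom hlim
    refine tendsto_nhds_unique hconv ?_
    simp_rw [hFzero]
    exact tendsto_const_nhds
  -- Step 2: `a → ∞`
  have hlim2 : ∀ u : FunctionSpaces.Torus.energySpace d, Tendsto (fun n : ℕ =>
      galerkinWeight (‖u‖ ^ 2 / ((n : ℝ) + 1)) * Flim u) atTop (𝓝 (Flim u)) := by
    intro u
    have h1 : Tendsto (fun n : ℕ => ‖u‖ ^ 2 / ((n : ℝ) + 1)) atTop (𝓝 0) := by
      have h := (tendsto_one_div_add_atTop_nhds_zero_nat (𝕜 := ℝ)).const_mul (‖u‖ ^ 2)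
      rw [mul_zero] at h
      refine h.congr fun n => ?_
      ring
    have h2 := (continuous_galerkinWeight.tendsto 0).comp h1
    rw [galerkinWeight_zero] at h2
    have h3 := h2.mul_const (Flim u)
    rw [one_mul] at h3
    exact h3
  have hdom2 : ∀ n : ℕ, ∀ᵐ u ∂μ,
      ‖galerkinWeight (‖u‖ ^ 2 / ((n : ℝ) + 1)) * Flim u‖ ≤ Cw * ‖Flim u‖ := by
    intro n
    refine ae_of_all _ fun u => ?_
    rw [norm_mul, Real.norm_eq_abs]
    exact mul_le_mul_of_nonneg_right (hCw _) (norm_nonneg _)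
  have hmeas2 : ∀ n : ℕ, AEStronglyMeasurable
      (fun u : FunctionSpaces.Torus.energySpace d => galerkinWeight (‖u‖ ^ 2 / ((n : ℝ) + 1)) * Flim u) μ := by
    intro n
    have hc : Continuous fun u : FunctionSpaces.Torus.energySpace d => galerkinWeight (‖u‖ ^ 2 / ((n : ℝ) + 1)) :=
      continuous_galerkinWeight.comp ((continuous_norm.pow 2).div_const _)
    exact hc.aestronglyMeasurable.mul hFlim_int.aestronglyMeasurable
  have hconv2 := tendsto_integral_of_dominated_convergence (fun u => Cw * ‖Flim u‖) hmeas2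
    (hFlim_int.norm.const_mul Cw) hdom2 (ae_of_all _ hlim2)
  have hFlim0 : ∫ u, Flim u ∂μ = 0 := by
    refine tendsto_nhds_unique hconv2 ?_
    simp_rw [hlevel]
    exact tendsto_const_nhds
  -- read off the energy equation
  have hsplit : ∫ u, Flim u ∂μ = (∫ u, pairing (u : L2T d) f ∂μ) - ν * ∫ u, G u ∂μ := by
    rw [hFlim]
    simp_rw [hpair]
    rw [integral_sub hI1 (hI2.const_mul ν), integral_const_mul]
  have hens : (ensembleEnstrophy μ).toReal = ∫ u, G u ∂μ := by
    rw [ensembleEnstrophy, integral_toReal measurable_eGradNormSq_coe.aemeasurable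
      hμ.ae_eGradNormSq_lt_top]
  rw [hens]
  linarith [hsplit.symm.trans hFlim0]

end EnergyEquation

end Torus

end Literature.Analysis.FluidPDE
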